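import Literature.Geometry.Riemannian.BakryEmeryCompleteFisherEntropy
import HarnessLib
/-!
# The weighted heat flow on a complete `CD(K,∞)` manifold with first-order (Gaffney) cut-offs, III: existence of the energy-class
# flow (Lions' very weak solutions, perfect-square coercivity of the ground-state transform, forcing, hypoellipticity, flat corrector)
# and the Bakry–Émery logarithmic Sobolev inequality — the named fact `bakryEmery_logSobolev_complete` HOLDS
# (Bakry–Émery 1985; Bakry–Gentil–Ledoux 2014 Prop. 5.7.1, Cor. 5.7.2; Carrillo–Ni 2009 Thm. 3.1)

**Existence of the energy-class weighted heat flow from data constant outside a compact set on a COMPLETE weighted manifold with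
ARBITRARY smooth potential, and the Bakry–Émery logarithmic Sobolev inequality `∫ φ e^φ e^{-V} ≤ (2K)⁻¹ ∫ |∇φ|² e^φ e^{-V}` under
`CD(K,∞)`, `K > 0`** (Bakry–Émery 1985 [BakryEmery1985]; Bakry–Gentil–Ledoux (2014) Prop. 5.7.1 and Cor. 5.7.2 (p. 268), Thm. 5.2.1
(p. 238), §3.2 (pp. 141–148), §1.15.7 (ground-state transform) [BakryGentilLedoux2014]; Carrillo–Ni, Comm. Anal. Geom. 17 (2009) Thm.
3.1 (p. 7) [CarrilloNi2009]; the linear existence theory after F. Trèves, *Basic Linear Partial Differential Equations* (1975) §§40–41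
[Treves1975] (Lions' very weak solutions from an ENERGY INEQUALITY), hypoellipticity of the heat operator (Hörmander 1967
[Hormander1967]) and interior regularity (Evans 2010 §7.1.1 [Evans2010])): Lions' very weak existence for the static linear heat
equation from an energy inequality, coercivity of the ground-state transformed operator with potential `¼|∇V|² − ½ΔV + 1` WITHOUT
a lower bound on the potential (perfect square), the forced transformed problem with arbitrary smooth potential, the Cauchy
problem with compactly supported data, smooth very weak solutions are classical, the flat corrector, existence of the weighted heat
flow `∂ₛρ = Δ_g ρ − g⁻¹(dV, dρ)` on `[0, T]` in the energy class, and the assembly `logSobolev_eventuallyConst_gaffney` (LSI for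
densities `e^φ` with `φ` constant outside a compact set: flow, a-priori bounds, unit mass, entropy production `H(f) − H(u_T) ≤ I(f)/2K`,
`H(u_T(T)) → 0`), whence — by the density step `bakryEmery_logSobolev_complete_of_eventuallyConst` of
`BakryEmeryLogSobolevReduction.lean` — the EXACT discharge `Literature.Geometry.Riemannian.bakryEmery_logSobolev_complete_holds` of
the named fact of `BakryEmeryLogSobolev.lean` (last Part).
RE-HOMED into `Literature/` by the Hodge foundations lane (`lit-hodgefound`, seat p20, generation 41): verbatim DECLARATION-LEVEL
ports, in dependency order and each under its original module docstring, of the theorems of the theorem-only modules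
`Summits/SmoothPoincare4/SmoothPoincare4/Theorems/EntropyRung{BakryEmeryLogSobolev{VeryWeak, SchrodingerCoercivity, Forcing, Cauchy, FlowExistence,
Complete}, NoncompactShrinkerGapHeat{HypoellipticNoncompact, ClassicalNoncompact, FlatCorrector}}.lean`
(cell of the route `EntropyRung` of the smooth Poincaré 4 summit, where they served the analytic support item "Bakry–Émery
logarithmic Sobolev inequality"; they certify classical heat-flow analysis on a complete weighted manifold and are independent
of that route's topological target), namespaces `Summit.SmoothPoincare4.SmoothPoincare4.Theorems.{NoncompactShrinkerGapHeat,
BakryEmeryComplete}` re-rooted as `Literature.Geometry.Riemannian.{NoncompactShrinkerGapHeat, BakryEmeryComplete}`.  The 24 theorems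
of the same cone that other seats had already re-homed (`Geometry/Riemannian/{WeightedHeatCutoffCalculus, WeightedHeatFlowNoncompact,
LinearHeatVeryWeakNoncompact, LinearHeatWeakRegularityNoncompact, LinearHeatCauchyNoncompact}`, namespace
`Literature.Geometry.Riemannian`) are IMPORTED, not duplicated.  Everything is built on the tree's Literature layer
`Literature/Geometry/{Riemannian, Lorentzian}/` (`PseudoRiemannianMetric`, `laplaceBeltrami`, `weightedLaplacian`, `gradSq`,
`innerDual`, `riemVolume`, Gaffney cut-offs `exists_cutoff_seq_of_isGeodesicallyComplete`, weighted Green identities, the linear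
heat equation packages).  Theorem-only file: no definition, no named fact (D-0026); imports Mathlib/Literature only; every
declaration carries the citation of the printed step it formalises or serves.  The Summits originals stay in place (transitional
duplication; twins = same short names under `Summit.SmoothPoincare4.SmoothPoincare4.Theorems.…`).  Nothing here bears on any
summit statement.
Builds on `BakryEmeryCompleteGaffneyEnergy.lean` and `BakryEmeryCompleteFisherEntropy.lean` (same directory).
-/

noncomputable section

/-!
## Part 1 — port of `Summits/SmoothPoincare4/SmoothPoincare4/Theorems/EntropyRungBakryEmeryLogSobolevVeryWeak.lean` (1 declarations kept)

# Lions' very weak existence for the static linear heat equation on a complete manifold from an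
# ENERGY INEQUALITY

This is the shrinker toolkit's `exists_veryWeak_linearHeat_static`
(`Summits/…/EntropyRungNoncompactShrinkerGapHeatVeryWeakNoncompact.lean`,
Trèves 1975, §41: J.-L. Lions' projection lemma in `L²(M × (a, b), V_g ⊗ ds)` with the test space of
smooth functions vanishing off `K × ℝ`, `K` compact, and for `s ≥ b'`, `b' < b`) with its ONE use of the
pointwise hypothesis `Q ≥ 1` — the energy inequality `‖φ‖² ≤ ⟪𝒜φ, φ⟫`,
`𝒜φ = −∂ₛφ − Δ_g φ(·, s) + Qφ` — turned into a hypothesis `hcoer`. The proof is otherwise that file's,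
verbatim (same author line of ideas; adapted here because the weighted manifold of this development
`BakryEmeryLogSobolev` has an ARBITRARY smooth weight, for which the ground-state potential
`Q_V = ¼|∇V|² − ½ΔV` is unbounded below and coercivity comes instead from the perfect square of
`EntropyRungBakryEmeryLogSobolevSchrodingerCoercivity.lean`).

**Theorem** (`exists_veryWeak_linearHeat_of_energyIneq`). `(M, g)` Riemannian modelled on `ℝⁿ` (Hausdorff,
second countable, `T₃` — NOT compact), `Q, G` smooth on `M × ℝ` with `G` compactly supported, `a < b`, and
the energy inequality `∫_{M×(a,b)} φ² ≤ ∫_{M×(a,b)} φ 𝒜φ` for every smooth `φ` vanishing off `K × ℝ` (`K`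
compact) and for `s ≥ b`. Then there is a measurable `u ∈ L²(V_g ⊗ ds)`, `u = 0` for `s ∉ (a, b)`, with
`∫ u 𝒜ζ d(V_g ⊗ ds) = ∫_{M×(a,b)} G ζ d(V_g ⊗ ds)` for every smooth compactly supported `ζ` with
`tsupport ζ ⊆ M × (−∞, b)`. Everything is proved; no definitions.

## References

* [Treves1975] F. Trèves, *Basic Linear Partial Differential Equations* (1975), §41, Lemma 41.2, (41.7),
  Thm. 40.1.
* J.-L. Lions, *Équations différentielles opérationnelles et problèmes aux limites* (1961).
-/

section Part1

open scoped _root_.Manifold _root_.ContDiff _root_.ENNReal _root_.NNReal _root_.Topology _root_.InnerProductSpace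
open _root_.MeasureTheory _root_.Set _root_.Filter
open Literature.Geometry.Lorentzian Literature.Geometry.Riemannian

namespace Literature.Geometry.Riemannian.BakryEmeryComplete

open NoncompactShrinkerGapHeat

section VeryWeak

variable {n : ℕ} {M : Type*} [TopologicalSpace M] [T2Space M] [SecondCountableTopology M]
  [ChartedSpace (EuclideanSpace ℝ (Fin n)) M] [IsManifold (𝓡 n) ∞ M] [T3Space M] [MeasurableSpace M]
  [BorelSpace M]
  {g : PseudoRiemannianMetric (𝓡 n) ∞ (EuclideanSpace ℝ (Fin n)) (TangentSpace (𝓡 n) : M → Type _)}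

/-- **Lions' very weak `L²` existence for the static linear heat equation with zero initial data on a
complete manifold, from the energy inequality** (Trèves 1975, §41, proof of Thm. 40.1 via Lemma 41.2; the
shrinker toolkit's `exists_veryWeak_linearHeat_static` with its hypothesis `Q ≥ 1` replaced by the energy
inequality `hcoer` it was used for). [cite: Treves1975, §41, Lemma 41.2 and Thm. 40.1] -/
theorem exists_veryWeak_linearHeat_of_energyIneq (hg : g.IsRiemannian) {Q G : ℝ → M → ℝ}
    (hQ : ContMDiff ((𝓡 n).prod 𝓘(ℝ, ℝ)) 𝓘(ℝ, ℝ) ∞ fun p : M × ℝ ↦ Q p.2 p.1)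
    (hG : ContMDiff ((𝓡 n).prod 𝓘(ℝ, ℝ)) 𝓘(ℝ, ℝ) ∞ fun p : M × ℝ ↦ G p.2 p.1)
    (hGc : HasCompactSupport fun p : M × ℝ ↦ G p.2 p.1) {a b : ℝ}
    (hcoer : ∀ (K : Set M) (φ : M × ℝ → ℝ), IsCompact K → ContMDiff ((𝓡 n).prod 𝓘(ℝ, ℝ)) 𝓘(ℝ, ℝ) ∞ φ →
      (∀ p : M × ℝ, p.1 ∉ K → φ p = 0) → (∀ (x : M) (s : ℝ), b ≤ s → φ (x, s) = 0) →
      ∫ p in univ ×ˢ Ioo a b, φ p ^ 2 ∂g.riemVolume.prod (volume : Measure ℝ) ≤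
        ∫ p in univ ×ˢ Ioo a b, φ p * (-(deriv (fun s ↦ φ (p.1, s)) p.2) -
          g.laplaceBeltrami (fun x ↦ φ (x, p.2)) p.1 + Q p.2 p.1 * φ p)
          ∂g.riemVolume.prod (volume : Measure ℝ)) :
    ∃ u : M × ℝ → ℝ, Measurable u ∧ MemLp u 2 (g.riemVolume.prod (volume : Measure ℝ)) ∧
      (∀ p : M × ℝ, p.2 ∉ Ioo a b → u p = 0) ∧
      ∀ ζ : M × ℝ → ℝ, ContMDiff ((𝓡 n).prod 𝓘(ℝ, ℝ)) 𝓘(ℝ, ℝ) ∞ ζ → HasCompactSupport ζ →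
        tsupport ζ ⊆ univ ×ˢ Iio b →
        ∫ p, u p * (-(deriv (fun s ↦ ζ (p.1, s)) p.2) - g.laplaceBeltrami (fun x ↦ ζ (x, p.2)) p.1 +
            Q p.2 p.1 * ζ p) ∂(g.riemVolume.prod (volume : Measure ℝ)) =
          ∫ p in univ ×ˢ Ioo a b, G p.2 p.1 * ζ p ∂(g.riemVolume.prod (volume : Measure ℝ)) := by
  classical
  haveI : LocallyCompactSpace M := ChartedSpace.locallyCompactSpace (EuclideanSpace ℝ (Fin n)) M
  set μ₀ : Measure M := g.riemVolume with hμ₀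
  haveI : IsFiniteMeasureOnCompacts μ₀ := CarrilloNi2009_shrinkerLSI.isFiniteMeasureOnCompacts_riemVolume hg
  have hfam : IsContMDiffFamilyOn ∞ (fun _ : ℝ ↦ g) univ := isContMDiffFamilyOn_const g univ
  set S : Set (M × ℝ) := univ ×ˢ Ioo a b with hS
  have hSm : MeasurableSet S := MeasurableSet.univ.prod measurableSet_Ioo
  set ν : Measure (M × ℝ) := (μ₀.prod (volume : Measure ℝ)).restrict S with hν
  -- the adjoint operator
  set A : (M × ℝ → ℝ) → (M × ℝ → ℝ) := fun φ p ↦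
    -(deriv (fun s ↦ φ (p.1, s)) p.2) - g.laplaceBeltrami (fun x ↦ φ (x, p.2)) p.1 +
      Q p.2 p.1 * φ p with hA
  have hAs : ∀ {φ : M × ℝ → ℝ}, ContMDiff ((𝓡 n).prod 𝓘(ℝ, ℝ)) 𝓘(ℝ, ℝ) ∞ φ →
      ContMDiff ((𝓡 n).prod 𝓘(ℝ, ℝ)) 𝓘(ℝ, ℝ) ∞ (A φ) := fun hφ ↦
    ((contMDiff_deriv_time hφ).neg.sub (contMDiff_laplaceBeltrami_family hfam hφ)).add (hQ.mul hφ)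
  -- `A φ` vanishes off `K × ℝ` when `φ` does
  have hA0 : ∀ {φ : M × ℝ → ℝ} {K : Set M}, IsCompact K → (∀ p : M × ℝ, p.1 ∉ K → φ p = 0) →
      ∀ p : M × ℝ, p.1 ∉ K → A φ p = 0 := by
    intro φ K hK hφK p hp
    have ht : (fun s ↦ φ (p.1, s)) = fun _ ↦ (0 : ℝ) := funext fun s ↦ hφK (p.1, s) hp
    have hev : (fun x ↦ φ (x, p.2)) =ᶠ[𝓝 p.1] fun _ ↦ (0 : ℝ) := by
      filter_upwards [hK.isClosed.isOpen_compl.mem_nhds hp] with x hx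
      exact hφK (x, p.2) hx
    simp only [hA]
    rw [ht, deriv_const, laplaceBeltrami_eq_zero_of_eventuallyEq_zero _ hev, hφK p hp]
    ring
  -- continuous functions vanishing off some `K × ℝ` are in `L²(ν)`
  have hmemS : ∀ {F : M × ℝ → ℝ} {K : Set M}, IsCompact K → Continuous F →
      (∀ p : M × ℝ, p.1 ∉ K → F p = 0) → MemLp F 2 ν := by
    intro F K hK hF hF0
    rw [memLp_two_iff_integrable_sq hF.aestronglyMeasurable]
    have h2 : ∀ p : M × ℝ, p.1 ∉ K → F p ^ 2 = 0 := fun p hp ↦ by rw [hF0 p hp]; ring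
    exact integrableOn_strip_of_continuous_of_vanish hg hK (hF.fun_pow 2) h2 a b
  -- the test space: smooth, vanishing off `K × ℝ` for a compact `K`, and for `s ≥ b'`, some `b' < b`
  set Φ : Submodule ℝ (M × ℝ → ℝ) :=
    { carrier := {φ | ContMDiff ((𝓡 n).prod 𝓘(ℝ, ℝ)) 𝓘(ℝ, ℝ) ∞ φ ∧
        (∃ K : Set M, IsCompact K ∧ ∀ p : M × ℝ, p.1 ∉ K → φ p = 0) ∧
        ∃ b' < b, ∀ p : M × ℝ, b' ≤ p.2 → φ p = 0}
      add_mem' := by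
        rintro φ ψ ⟨hφ, ⟨K₁, hK₁, hK₁0⟩, b₁, hb₁, h₁⟩ ⟨hψ, ⟨K₂, hK₂, hK₂0⟩, b₂, hb₂, h₂⟩
        refine ⟨hφ.add hψ, ⟨K₁ ∪ K₂, hK₁.union hK₂, fun p hp ↦ ?_⟩, max b₁ b₂, max_lt hb₁ hb₂,
          fun p hp ↦ ?_⟩
        · rw [mem_union, not_or] at hp
          simp only [Pi.add_apply, hK₁0 p hp.1, hK₂0 p hp.2, add_zero]
        · simp only [Pi.add_apply, h₁ p ((le_max_left _ _).trans hp), h₂ p ((le_max_right _ _).trans hp),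
            add_zero]
      zero_mem' := ⟨contMDiff_const, ⟨∅, isCompact_empty, fun p _ ↦ rfl⟩, b - 1, by linarith,
        fun p _ ↦ rfl⟩
      smul_mem' := by
        rintro c φ ⟨hφ, ⟨K₁, hK₁, hK₁0⟩, b₁, hb₁, h₁⟩
        refine ⟨(contMDiff_const.mul hφ :), ⟨K₁, hK₁, fun p hp ↦ ?_⟩, b₁, hb₁, fun p hp ↦ ?_⟩
        · change c * φ p = 0
          rw [hK₁0 p hp, mul_zero]
        · change c * φ p = 0
          rw [h₁ p hp, mul_zero] } with hΦ
  have hΦs : ∀ φ : Φ, ContMDiff ((𝓡 n).prod 𝓘(ℝ, ℝ)) 𝓘(ℝ, ℝ) ∞ (φ : M × ℝ → ℝ) := fun φ ↦ φ.2.1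
  have hΦK : ∀ φ : Φ, ∃ K : Set M, IsCompact K ∧ ∀ p : M × ℝ, p.1 ∉ K → (φ : M × ℝ → ℝ) p = 0 :=
    fun φ ↦ φ.2.2.1
  have hΦb : ∀ φ : Φ, ∀ x : M, ∀ s, b ≤ s → (φ : M × ℝ → ℝ) (x, s) = 0 := by
    intro φ x s hs
    obtain ⟨b', hb', h'⟩ := φ.2.2.2
    exact h' (x, s) (hb'.le.trans hs)
  -- the linear maps into `L²(ν)`
  have hmemφ : ∀ φ : Φ, MemLp (φ : M × ℝ → ℝ) 2 ν := fun φ ↦ by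
    obtain ⟨K, hK, hK0⟩ := hΦK φ
    exact hmemS hK (hΦs φ).continuous hK0
  have hmemA : ∀ φ : Φ, MemLp (A φ) 2 ν := fun φ ↦ by
    obtain ⟨K, hK, hK0⟩ := hΦK φ
    exact hmemS hK (hAs (hΦs φ)).continuous (hA0 hK hK0)
  set j : Φ →ₗ[ℝ] Lp ℝ 2 ν :=
    { toFun := fun φ ↦ (hmemφ φ).toLp (φ : M × ℝ → ℝ)
      map_add' := fun φ ψ ↦ MemLp.toLp_add (hmemφ φ) (hmemφ ψ)
      map_smul' := fun c φ ↦ MemLp.toLp_const_smul c (hmemφ φ) } with hj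
  have hAadd : ∀ φ ψ : Φ, A ((φ + ψ : Φ) : M × ℝ → ℝ) = A φ + A ψ := by
    intro φ ψ; funext p
    exact heatAdjoint_static_add Q (hΦs φ) (hΦs ψ) p
  have hAsmul : ∀ (c : ℝ) (φ : Φ), A ((c • φ : Φ) : M × ℝ → ℝ) = c • A φ := by
    intro c φ; funext p
    exact heatAdjoint_static_smul Q (hΦs φ) c p
  set K : Φ →ₗ[ℝ] Lp ℝ 2 ν :=
    { toFun := fun φ ↦ (hmemA φ).toLp (A φ)
      map_add' := fun φ ψ ↦ by
        have h1 : (hmemA (φ + ψ)).toLp (A ((φ + ψ : Φ) : M × ℝ → ℝ)) =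
            ((hmemA φ).add (hmemA ψ)).toLp (A φ + A ψ) :=
          MemLp.toLp_congr _ _ (Eventually.of_forall fun p ↦ by rw [hAadd])
        rw [h1]; exact MemLp.toLp_add (hmemA φ) (hmemA ψ)
      map_smul' := fun c φ ↦ by
        have h1 : (hmemA (c • φ)).toLp (A ((c • φ : Φ) : M × ℝ → ℝ)) =
            ((hmemA φ).const_smul c).toLp (c • A φ) :=
          MemLp.toLp_congr _ _ (Eventually.of_forall fun p ↦ by rw [hAsmul])
        rw [h1]; exact MemLp.toLp_const_smul c (hmemA φ) } with hK
  -- `G` vanishes off `KG × ℝ`, `KG` compact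
  set KG : Set M := Prod.fst '' tsupport (fun p : M × ℝ ↦ G p.2 p.1) with hKG
  have hKGc : IsCompact KG := hGc.isCompact.image continuous_fst
  have hG0 : ∀ p : M × ℝ, p.1 ∉ KG → G p.2 p.1 = 0 := fun p hp ↦
    image_eq_zero_of_notMem_tsupport (f := fun p : M × ℝ ↦ G p.2 p.1) fun h ↦ hp ⟨p, h, rfl⟩
  have hGmem : MemLp (fun p : M × ℝ ↦ G p.2 p.1) 2 ν := hmemS hKGc hG.continuous hG0
  set ℓ : Φ →ₗ[ℝ] ℝ :=
    { toFun := fun φ ↦ ∫ p, G p.2 p.1 * (φ : M × ℝ → ℝ) p ∂ν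
      map_add' := fun φ ψ ↦ by
        have hi : ∀ θ : Φ, Integrable (fun p ↦ G p.2 p.1 * (θ : M × ℝ → ℝ) p) ν := fun θ ↦ by
          have h0 : ∀ p : M × ℝ, p.1 ∉ KG → G p.2 p.1 * (θ : M × ℝ → ℝ) p = 0 := fun p hp ↦ by
            rw [hG0 p hp, zero_mul]
          exact integrableOn_strip_of_continuous_of_vanish hg hKGc
            (hG.continuous.fun_mul (hΦs θ).continuous) h0 a b
        rw [← integral_add (hi φ) (hi ψ)]
        exact integral_congr_ae (Eventually.of_forall fun p ↦ by
          simp only [Submodule.coe_add, Pi.add_apply]; ring)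
      map_smul' := fun c φ ↦ by
        rw [RingHom.id_apply, smul_eq_mul, ← MeasureTheory.integral_const_mul]
        exact integral_congr_ae (Eventually.of_forall fun p ↦ by
          simp only [Submodule.coe_smul, Pi.smul_apply, smul_eq_mul]; ring) } with hℓ
  -- the gauge and the constant
  set nΦ : Φ → ℝ := fun φ ↦ Real.sqrt (∫ p, (φ : M × ℝ → ℝ) p ^ 2 ∂ν) with hnΦ
  set C₁ : ℝ := Real.sqrt (∫ p, G p.2 p.1 ^ 2 ∂ν) with hC₁
  -- (i) coercivity
  have hcoerc : ∀ φ : Φ, 1 * nΦ φ ^ 2 ≤ ⟪K φ, j φ⟫_ℝ := by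
    intro φ
    have hint_eq : ⟪K φ, j φ⟫_ℝ = ∫ p, A φ p * (φ : M × ℝ → ℝ) p ∂ν :=
      inner_toLp_toLp_eq_integral (hmemA φ) (hmemφ φ)
    rw [one_mul, hint_eq, hnΦ]
    dsimp only
    rw [Real.sq_sqrt (integral_nonneg fun p ↦ sq_nonneg _)]
    obtain ⟨K', hK', hK'0⟩ := hΦK φ
    have hen := hcoer K' φ hK' (hΦs φ) hK'0 (hΦb φ)
    rw [hν]
    calc ∫ p in S, (φ : M × ℝ → ℝ) p ^ 2 ∂μ₀.prod (volume : Measure ℝ)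
        ≤ _ := hen
      _ = ∫ p in S, A φ p * (φ : M × ℝ → ℝ) p ∂μ₀.prod (volume : Measure ℝ) :=
          integral_congr_ae (Eventually.of_forall fun p ↦ by simp only [hA]; ring)
  -- (ii) the inclusion is bounded (constant `1`)
  have hemb : ∀ φ : Φ, ‖j φ‖ ≤ 1 * nΦ φ := by
    intro φ
    change ‖(hmemφ φ).toLp (φ : M × ℝ → ℝ)‖ ≤ 1 * nΦ φ
    rw [norm_toLp_two_eq_sqrt, one_mul]
  -- (iii) the functional is bounded (Cauchy–Schwarz)
  have hℓb : ∀ φ : Φ, |ℓ φ| ≤ C₁ * nΦ φ := by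
    intro φ
    change |∫ p, G p.2 p.1 * (φ : M × ℝ → ℝ) p ∂ν| ≤ C₁ * nΦ φ
    have hcs := abs_real_inner_le_norm (hGmem.toLp _) ((hmemφ φ).toLp _)
    rw [inner_toLp_toLp_eq_integral, norm_toLp_two_eq_sqrt, norm_toLp_two_eq_sqrt] at hcs
    exact hcs
  -- Lions' projection lemma
  obtain ⟨U, hU⟩ := Literature.Analysis.PDE.lions_projection K j ℓ nΦ one_pos zero_le_one (Real.sqrt_nonneg _)
    (fun φ ↦ Real.sqrt_nonneg _) hcoerc hemb hℓb
  -- a measurable representative, extended by zero off the strip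
  set Ut : M × ℝ → ℝ := (Lp.memLp U).1.mk U with hUt
  have hUtm : Measurable Ut := (Lp.memLp U).1.stronglyMeasurable_mk.measurable
  have hUUt : (U : M × ℝ → ℝ) =ᵐ[ν] Ut := (Lp.memLp U).1.ae_eq_mk
  have hUt2 : MemLp Ut 2 ν := (Lp.memLp U).ae_eq hUUt
  set u : M × ℝ → ℝ := S.indicator Ut with hu
  refine ⟨u, hUtm.indicator hSm, ?_, ?_, ?_⟩
  · rw [hu, memLp_indicator_iff_restrict hSm]; exact hUt2
  · intro p hp
    rw [hu, indicator_of_notMem (fun h' : p ∈ S ↦ hp h'.2)]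
  · intro ζ hζ hζc hζT
    -- `ζ` belongs to the test space
    have hζΦ : ζ ∈ Φ := by
      refine ⟨hζ, ⟨Prod.fst '' tsupport ζ, hζc.isCompact.image continuous_fst, fun p hp ↦
        image_eq_zero_of_notMem_tsupport fun h ↦ hp ⟨p, h, rfl⟩⟩, ?_⟩
      set Kt : Set ℝ := Prod.snd '' tsupport ζ with hKt
      have hKtc : IsCompact Kt := hζc.isCompact.image continuous_snd
      rcases Kt.eq_empty_or_nonempty with he | hne
      · refine ⟨b - 1, by linarith, fun p _ ↦ ?_⟩
        have : p ∉ tsupport ζ := fun h' ↦ by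
          have : p.2 ∈ Kt := ⟨p, h', rfl⟩
          rw [he] at this; exact this
        exact image_eq_zero_of_notMem_tsupport this
      · obtain ⟨s₀, hs₀, hmax⟩ := hKtc.exists_isMaxOn hne continuous_id.continuousOn
        obtain ⟨p₀, hp₀, rfl⟩ := hs₀
        have hs₀b : p₀.2 < b := (hζT hp₀).2
        refine ⟨(p₀.2 + b) / 2, by linarith, fun p hp ↦ ?_⟩
        have : p ∉ tsupport ζ := fun h' ↦ by
          have hle : p.2 ≤ p₀.2 := hmax ⟨p, h', rfl⟩
          linarith
        exact image_eq_zero_of_notMem_tsupport this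
    have key := hU ⟨ζ, hζΦ⟩
    -- unfold both sides
    have hKζ : ⟪U, K ⟨ζ, hζΦ⟩⟫_ℝ = ∫ p, Ut p * A ζ p ∂ν := by
      have h1 : ⟪U, K ⟨ζ, hζΦ⟩⟫_ℝ = ⟪hUt2.toLp Ut, (hmemA ⟨ζ, hζΦ⟩).toLp (A ζ)⟫_ℝ := by
        congr 1
        exact (Lp.toLp_coeFn U (Lp.memLp U)).symm.trans (MemLp.toLp_congr _ _ hUUt)
      rw [h1, inner_toLp_toLp_eq_integral]
    rw [hKζ] at key
    change ∫ p, Ut p * A ζ p ∂ν = ∫ p, G p.2 p.1 * ζ p ∂ν at key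
    rw [hν] at key
    have hlhs : ∫ p, u p * A ζ p ∂μ₀.prod (volume : Measure ℝ) =
        ∫ p in S, Ut p * A ζ p ∂μ₀.prod (volume : Measure ℝ) := by
      rw [← MeasureTheory.integral_indicator hSm]
      refine integral_congr_ae (Eventually.of_forall fun p ↦ ?_)
      simp only [hu]
      by_cases hp : p ∈ S
      · rw [indicator_of_mem hp, indicator_of_mem hp]
      · rw [indicator_of_notMem hp, indicator_of_notMem hp, zero_mul]
    rw [hlhs]
    exact key

end VeryWeak

end Literature.Geometry.Riemannian.BakryEmeryComplete

end Part1

/-!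
## Part 2 — port of `Summits/SmoothPoincare4/SmoothPoincare4/Theorems/EntropyRungBakryEmeryLogSobolevSchrodingerCoercivity.lean` (3 declarations kept)

# Coercivity of the ground-state transformed heat operator WITHOUT a lower bound on the potential

Setting: `M` modelled on `ℝⁿ` (Hausdorff, second countable, `T₃`, Borel — NOT compact), `g` Riemannian with
its Levi-Civita connection, `V` smooth (NO further assumption), `L = Δ_g − g⁻¹(dV, d·)` and its ground-state
conjugate `e^{-V/2} L e^{V/2} = Δ_g − Q_V`, `Q_V = ¼|∇V|² − ½Δ_gV`. For a general `V` the potential `Q_V`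
is unbounded below, so the coercivity `Q ≥ 1` of the shrinker toolkit's Lions argument
(`energy_le_integral_mul_heatAdjoint_static`) is not available. It is replaced by the PERFECT SQUARE

  `∫ (−φ Δ_gφ + Q_V φ²) dV_g = ∫ |∇(e^{V/2}φ)|²_g e^{-V} dV_g ≥ 0`  (`φ ∈ C_c^∞`),

which holds for every smooth `V`:

* `weightedLaplacian_conj` — the conjugation identity `L(e^{V/2}φ) = e^{V/2}(Δ_gφ − Q_V φ)` (pointwise;
  the algebra of `heatDrift_of_potential`, `WeightedHeatFlowFromLinearHeat.lean`);
* `integral_schrodingerForm_nonneg` — `0 ≤ ∫ (−φ Δ_gφ + Q_V φ²) dV_g` for `φ ∈ C_c^∞` (the weighted Green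
  identity with compact support, `weightedGreen_left`);
* `energy_le_integral_mul_schrodingerAdjoint` — **the energy inequality of Lions' projection method for
  `𝒜φ = −∂ₛφ − Δ_gφ + (Q_V + 1)φ`**: for `φ` smooth on `M × ℝ`, vanishing off `K × ℝ` (`K` compact) and for
  `s ≥ b`, `∫_{M×(a,b)} φ² ≤ ∫_{M×(a,b)} φ 𝒜φ` — with NO lower bound on `Q_V` (Trèves 1975, (41.7)).

This is the input that lets the heat semigroup of a complete weighted manifold be constructed by the
`L²` method for an ARBITRARY smooth weight `e^{-V}` (Bakry–Gentil–Ledoux 2014, §3.2.3, p. 142: the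
generator is the Friedrichs extension of a NONNEGATIVE form). Everything is proved; no definitions.

## References

* [Treves1975] F. Trèves, *Basic Linear Partial Differential Equations* (1975), §41, (41.7), Lemma 41.2.
* [BakryGentilLedoux2014] D. Bakry, I. Gentil, M. Ledoux (2014), §3.2.3 (p. 142) and §1.15.
-/

section Part2

open scoped _root_.Manifold _root_.ContDiff _root_.ENNReal _root_.NNReal _root_.Topology
open _root_.MeasureTheory _root_.Set _root_.Filter
open Literature.Geometry.Lorentzian Literature.Geometry.Riemannian

namespace Literature.Geometry.Riemannian.BakryEmeryComplete

open NoncompactShrinkerGapHeat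

section Coercivity

variable {n : ℕ} {M : Type*} [TopologicalSpace M] [T2Space M] [SecondCountableTopology M]
  [ChartedSpace (EuclideanSpace ℝ (Fin n)) M] [IsManifold (𝓡 n) ∞ M] [T3Space M]
  [MeasurableSpace M] [BorelSpace M]
  {g : PseudoRiemannianMetric (𝓡 n) ∞ (EuclideanSpace ℝ (Fin n)) (TangentSpace (𝓡 n) : M → Type _)}
  [g.HasLeviCivita]

omit [T2Space M] [SecondCountableTopology M] [T3Space M] [MeasurableSpace M] [BorelSpace M] in
/-- **The ground-state conjugation, pointwise**: for `φ` of class `C²` at `x` and `V` smooth,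
`L(e^{V/2}φ)(x) = e^{V(x)/2} (Δ_gφ(x) − (¼|∇V|² − ½Δ_gV)(x) φ(x))`, `L = Δ_g − g⁻¹(dV, d·)`
(`Δ(e^{V/2}φ) = e^{V/2}Δφ + φΔe^{V/2} + 2g⁻¹(de^{V/2}, dφ)`, `Δe^{V/2} = e^{V/2}(¼|∇V|² + ½ΔV)`,
`de^{V/2} = ½e^{V/2}dV`). [cite: BakryGentilLedoux2014, §1.15.7 (ground state transform)] -/
theorem weightedLaplacian_conj {V : M → ℝ} (hV : ContMDiff (𝓡 n) 𝓘(ℝ, ℝ) ∞ V) {φ : M → ℝ} {x : M}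
    (hφ : ContMDiffAt (𝓡 n) 𝓘(ℝ, ℝ) 2 φ x) :
    g.dalembertian (fun y ↦ Real.exp (V y / 2) * φ y) x
        - g.innerDual x (mvfderiv (𝓡 n) V x).toLinearMap
          (mvfderiv (𝓡 n) (fun y ↦ Real.exp (V y / 2) * φ y) x).toLinearMap =
      Real.exp (V x / 2) * (g.dalembertian φ x - (g.gradSq V x / 4 - g.dalembertian V x / 2) * φ x) := by
  have hV2 : ContMDiffAt (𝓡 n) 𝓘(ℝ, ℝ) 2 V x := (hV.of_le (WithTop.coe_le_coe.mpr le_top)).contMDiffAt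
  have hVd : MDifferentiableAt (𝓡 n) 𝓘(ℝ, ℝ) V x := hV.mdifferentiableAt (by simp)
  have hφd : MDifferentiableAt (𝓡 n) 𝓘(ℝ, ℝ) φ x := hφ.mdifferentiableAt (by norm_num)
  have hζ : ContDiff ℝ 2 (fun t : ℝ ↦ Real.exp (t / 2)) := Real.contDiff_exp.comp (contDiff_id.div_const 2)
  have hζ' : ∀ t : ℝ, HasDerivAt (fun t : ℝ ↦ Real.exp (t / 2)) (Real.exp (t / 2) / 2) t := by
    intro t
    have h1 : HasDerivAt (fun t : ℝ ↦ t / 2) (1 / 2) t := by simpa using (hasDerivAt_id t).div_const 2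
    have h2 := h1.exp
    convert h2 using 1
    ring
  have hd1 : deriv (fun t : ℝ ↦ Real.exp (t / 2)) = fun t ↦ Real.exp (t / 2) / 2 :=
    funext fun t ↦ (hζ' t).deriv
  have hd2 : deriv (deriv fun t : ℝ ↦ Real.exp (t / 2)) (V x) = Real.exp (V x / 2) / 4 := by
    rw [hd1]
    have h3 : HasDerivAt (fun t : ℝ ↦ Real.exp (t / 2) / 2) (Real.exp (V x / 2) / 2 / 2) (V x) :=
      (hζ' (V x)).div_const 2
    rw [h3.deriv]
    ring
  have hA : ContMDiffAt (𝓡 n) 𝓘(ℝ, ℝ) 2 (fun y ↦ Real.exp (V y / 2)) x := hζ.contDiffAt.comp_contMDiffAt hV2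
  have hAd : MDifferentiableAt (𝓡 n) 𝓘(ℝ, ℝ) (fun y ↦ Real.exp (V y / 2)) x := hA.mdifferentiableAt (by norm_num)
  -- `Δ e^{V/2}` and `d e^{V/2}`
  have hΔA : g.dalembertian (fun y ↦ Real.exp (V y / 2)) x =
      Real.exp (V x / 2) / 4 * g.gradSq V x + Real.exp (V x / 2) / 2 * g.dalembertian V x := by
    have h1 := g.dalembertian_real_comp (ζ := fun t : ℝ ↦ Real.exp (t / 2)) hV2 hζ.contDiffAt
    rw [show (fun y ↦ Real.exp (V y / 2)) = (fun t : ℝ ↦ Real.exp (t / 2)) ∘ V from rfl, h1, hd2, hd1]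
    rfl
  have hdA : (mvfderiv (𝓡 n) (fun y ↦ Real.exp (V y / 2)) x : TangentSpace (𝓡 n) x →ₗ[ℝ] ℝ) =
      (Real.exp (V x / 2) / 2) • (mvfderiv (𝓡 n) V x : TangentSpace (𝓡 n) x →ₗ[ℝ] ℝ) := by
    ext v
    simp only [ContinuousLinearMap.coe_coe, LinearMap.smul_apply, smul_eq_mul]
    exact mvfderiv_real_comp_apply (I := 𝓡 n) (hζ' (V x)) hVd v
  -- `Δ u` and `du` for `u = e^{V/2} φ`
  have hΔu := dalembertian_fun_mul g hA hφ
  have hdu : (mvfderiv (𝓡 n) (fun y ↦ Real.exp (V y / 2) * φ y) x : TangentSpace (𝓡 n) x →ₗ[ℝ] ℝ) =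
      Real.exp (V x / 2) • (mvfderiv (𝓡 n) φ x : TangentSpace (𝓡 n) x →ₗ[ℝ] ℝ)
        + (φ x * (Real.exp (V x / 2) / 2)) • (mvfderiv (𝓡 n) V x : TangentSpace (𝓡 n) x →ₗ[ℝ] ℝ) := by
    have hm := mvfderiv_fun_mul hAd hφd
    apply_fun (fun L : TangentSpace (𝓡 n) x →L[ℝ] ℝ ↦ (L : TangentSpace (𝓡 n) x →ₗ[ℝ] ℝ)) at hm
    rw [hm, ContinuousLinearMap.toLinearMap_add, ContinuousLinearMap.toLinearMap_smul,
      ContinuousLinearMap.toLinearMap_smul, hdA, smul_smul]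
  have hgV : g.innerDual x (mvfderiv (𝓡 n) V x : TangentSpace (𝓡 n) x →ₗ[ℝ] ℝ)
      (mvfderiv (𝓡 n) V x : TangentSpace (𝓡 n) x →ₗ[ℝ] ℝ) = g.gradSq V x := rfl
  have e1 : (mvfderiv (𝓡 n) V x).toLinearMap = (mvfderiv (𝓡 n) V x : TangentSpace (𝓡 n) x →ₗ[ℝ] ℝ) := rfl
  have e2 : (mvfderiv (𝓡 n) (fun y ↦ Real.exp (V y / 2) * φ y) x).toLinearMap =
      (mvfderiv (𝓡 n) (fun y ↦ Real.exp (V y / 2) * φ y) x : TangentSpace (𝓡 n) x →ₗ[ℝ] ℝ) := rfl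
  rw [e1, e2, hΔu, hΔA, hdA, hdu, g.innerDual_add_right, g.innerDual_smul_right, g.innerDual_smul_right,
    g.innerDual_smul_left, hgV, g.innerDual_comm x (mvfderiv (𝓡 n) V x : TangentSpace (𝓡 n) x →ₗ[ℝ] ℝ)
      (mvfderiv (𝓡 n) φ x : TangentSpace (𝓡 n) x →ₗ[ℝ] ℝ)]
  ring

/-- **The Schrödinger form of the ground-state transform is a perfect square**:
`0 ≤ ∫ (−φ Δ_gφ + Q_V φ²) dV_g` for `φ ∈ C_c^∞(M)` and every smooth `V`, `Q_V = ¼|∇V|² − ½ΔV`: with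
`ζ = e^{V/2}φ ∈ C_c^∞`, `φ(Δφ − Q_Vφ) = ζ (Lζ) e^{-V}` pointwise (`weightedLaplacian_conj`) and
`∫ ζ (Lζ) e^{-V} dV_g = −∫ |∇ζ|² e^{-V} dV_g ≤ 0` (`weightedGreen_left`). [cite: BakryGentilLedoux2014, §3.2.3 (p. 142)] -/
theorem integral_schrodingerForm_nonneg (hg : g.IsRiemannian) {V : M → ℝ} (hV : ContMDiff (𝓡 n) 𝓘(ℝ, ℝ) ∞ V)
    {φ : M → ℝ} (hφ : ContMDiff (𝓡 n) 𝓘(ℝ, ℝ) ∞ φ) (hφc : HasCompactSupport φ) :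
    0 ≤ ∫ x, (-(φ x * g.laplaceBeltrami φ x) + (g.gradSq V x / 4 - g.dalembertian V x / 2) * φ x ^ 2)
      ∂g.riemVolume := by
  have h1le : (1 : ℕ∞ω) ≤ (∞ : ℕ∞ω) := WithTop.coe_le_coe.mpr le_top
  have h2le : (2 : ℕ∞ω) ≤ (∞ : ℕ∞ω) := WithTop.coe_le_coe.mpr le_top
  set ζ : M → ℝ := fun y ↦ Real.exp (V y / 2) * φ y with hζdef
  have hE : ContMDiff (𝓡 n) 𝓘(ℝ, ℝ) ∞ (fun y ↦ Real.exp (V y / 2)) :=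
    (contMDiff_iff_contDiff.2 Real.contDiff_exp).comp (hV.div_const 2)
  have hζ : ContMDiff (𝓡 n) 𝓘(ℝ, ℝ) ∞ ζ := hE.mul hφ
  have hζc : HasCompactSupport ζ := hφc.mul_left
  -- the weighted Green identity for `a = b = ζ`
  have hG := weightedGreen_left hg (hζ.of_le h1le) hζc (hζ.of_le h2le) (hV.of_le h1le)
  -- pointwise: `ζ (Lζ) e^{-V} = φ (Δφ − Q_V φ)`
  have hpt : ∀ x, ζ x * (g.dalembertian ζ x
      - g.innerDual x (mvfderiv (𝓡 n) V x).toLinearMap (mvfderiv (𝓡 n) ζ x).toLinearMap) * Real.exp (-V x) =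
      -(-(φ x * g.laplaceBeltrami φ x) + (g.gradSq V x / 4 - g.dalembertian V x / 2) * φ x ^ 2) := by
    intro x
    have hφ2 : ContMDiffAt (𝓡 n) 𝓘(ℝ, ℝ) 2 φ x := (hφ.of_le h2le).contMDiffAt
    have h := weightedLaplacian_conj (g := g) hV hφ2
    simp only [hζdef] at h ⊢
    rw [h, PseudoRiemannianMetric.laplaceBeltrami_eq_dalembertian]
    have hee : Real.exp (V x / 2) * Real.exp (V x / 2) * Real.exp (-V x) = 1 := by
      rw [← Real.exp_add, ← Real.exp_add, show V x / 2 + V x / 2 + -V x = 0 by ring, Real.exp_zero]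
    calc Real.exp (V x / 2) * φ x * (Real.exp (V x / 2) *
          (g.dalembertian φ x - (g.gradSq V x / 4 - g.dalembertian V x / 2) * φ x)) * Real.exp (-V x)
        = (Real.exp (V x / 2) * Real.exp (V x / 2) * Real.exp (-V x)) *
            (φ x * (g.dalembertian φ x - (g.gradSq V x / 4 - g.dalembertian V x / 2) * φ x)) := by ring
      _ = _ := by rw [hee]; ring
  have heq : ∫ x, (-(φ x * g.laplaceBeltrami φ x) + (g.gradSq V x / 4 - g.dalembertian V x / 2) * φ x ^ 2)
        ∂g.riemVolume = ∫ x, g.innerDual x (mvfderiv (𝓡 n) ζ x).toLinearMap (mvfderiv (𝓡 n) ζ x).toLinearMap *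
          Real.exp (-V x) ∂g.riemVolume := by
    have e1 : ∫ x, (-(φ x * g.laplaceBeltrami φ x) + (g.gradSq V x / 4 - g.dalembertian V x / 2) * φ x ^ 2)
        ∂g.riemVolume = ∫ x, -(ζ x * (g.dalembertian ζ x
          - g.innerDual x (mvfderiv (𝓡 n) V x).toLinearMap (mvfderiv (𝓡 n) ζ x).toLinearMap) * Real.exp (-V x))
            ∂g.riemVolume := integral_congr_ae (Eventually.of_forall fun x ↦ by dsimp only; rw [hpt x, neg_neg])
    rw [e1, integral_neg, hG, neg_neg]
  rw [heq]
  exact integral_nonneg fun x ↦ mul_nonneg (g.innerDual_self_nonneg hg x _) (Real.exp_pos _).le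

/-- **The energy inequality of Lions' projection method for the ground-state transformed heat operator,
without a lower bound on the potential** (Trèves 1975, (41.7), with the perfect square above): on a
(non-compact) Riemannian manifold `(M, g)` modelled on `ℝⁿ`, for `V` smooth, `Q_V = ¼|∇V|² − ½ΔV`, `a < b`,
and every smooth `φ` on `M × ℝ` vanishing off `K × ℝ` (`K` compact) and for `s ≥ b`,
`∫_{M×(a,b)} φ² ≤ ∫_{M×(a,b)} φ (−∂ₛφ − Δ_gφ(·,s) + (Q_V + 1)φ)` (`∫ₐᵇ φ(−∂ₛφ) = ½φ(a)² ≥ 0`,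
`∫ (−φΔφ + Q_Vφ²) dV_g ≥ 0` at each time by `integral_schrodingerForm_nonneg`, Fubini).
[cite: Treves1975, §41, (41.7) and Lemma 41.2] [cite: BakryGentilLedoux2014, §3.2.3 (p. 142)] -/
theorem energy_le_integral_mul_schrodingerAdjoint (hg : g.IsRiemannian) {V : M → ℝ}
    (hV : ContMDiff (𝓡 n) 𝓘(ℝ, ℝ) ∞ V) {a b : ℝ} (hab : a < b) {K : Set M} (hK : IsCompact K)
    {φ : M × ℝ → ℝ} (hφ : ContMDiff ((𝓡 n).prod 𝓘(ℝ, ℝ)) 𝓘(ℝ, ℝ) ∞ φ)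
    (hφK : ∀ p : M × ℝ, p.1 ∉ K → φ p = 0) (hφb : ∀ (x : M) (s : ℝ), b ≤ s → φ (x, s) = 0) :
    ∫ p in univ ×ˢ Ioo a b, φ p ^ 2 ∂g.riemVolume.prod (volume : Measure ℝ) ≤
      ∫ p in univ ×ˢ Ioo a b, φ p * (-(deriv (fun s ↦ φ (p.1, s)) p.2) -
        g.laplaceBeltrami (fun x ↦ φ (x, p.2)) p.1
        + (g.gradSq V p.1 / 4 - g.dalembertian V p.1 / 2 + 1) * φ p) ∂g.riemVolume.prod (volume : Measure ℝ) := by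
  haveI : LocallyCompactSpace M := ChartedSpace.locallyCompactSpace (EuclideanSpace ℝ (Fin n)) M
  set μ₀ : Measure M := g.riemVolume with hμ₀
  haveI : IsFiniteMeasureOnCompacts μ₀ := CarrilloNi2009_shrinkerLSI.isFiniteMeasureOnCompacts_riemVolume hg
  have hfam : IsContMDiffFamilyOn ∞ (fun _ : ℝ ↦ g) univ := isContMDiffFamilyOn_const g univ
  set φt : M × ℝ → ℝ := fun p ↦ deriv (fun s ↦ φ (p.1, s)) p.2 with hφt
  set Δφ : M × ℝ → ℝ := fun p ↦ g.laplaceBeltrami (fun x ↦ φ (x, p.2)) p.1 with hΔφ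
  set QV : M → ℝ := fun x ↦ g.gradSq V x / 4 - g.dalembertian V x / 2 with hQV
  have hQVc : Continuous QV := (((contMDiff_gradSq g hV).div_const 4).sub
    ((contMDiff_dalembertian g hV).div_const 2)).continuous
  have hφts : ContMDiff ((𝓡 n).prod 𝓘(ℝ, ℝ)) 𝓘(ℝ, ℝ) ∞ φt := contMDiff_deriv_time hφ
  have hΔφs : ContMDiff ((𝓡 n).prod 𝓘(ℝ, ℝ)) 𝓘(ℝ, ℝ) ∞ Δφ := contMDiff_laplaceBeltrami_family hfam hφ
  -- the restricted product measure is a product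
  set νt : Measure ℝ := (volume : Measure ℝ).restrict (Ioo a b) with hνt
  haveI : IsFiniteMeasure νt := ⟨by rw [hνt, Measure.restrict_apply_univ]; exact measure_Ioo_lt_top⟩
  have hπ : (μ₀.prod (volume : Measure ℝ)).restrict (univ ×ˢ Ioo a b) = μ₀.prod νt := by
    rw [hνt, ← Measure.prod_restrict, Measure.restrict_univ]
  have hint : ∀ {F : M × ℝ → ℝ}, Continuous F → (∀ p : M × ℝ, p.1 ∉ K → F p = 0) →
      Integrable F (μ₀.prod νt) := fun hF hF0 ↦ by
    rw [← hπ]; exact integrableOn_strip_of_continuous_of_vanish hg hK hF hF0 a b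
  -- decomposition of the integrand
  have hdec : ∀ p, φ p * (-(deriv (fun s ↦ φ (p.1, s)) p.2) -
      g.laplaceBeltrami (fun x ↦ φ (x, p.2)) p.1
      + (g.gradSq V p.1 / 4 - g.dalembertian V p.1 / 2 + 1) * φ p) =
      -(φ p * φt p) + (-(φ p * Δφ p) + QV p.1 * φ p ^ 2) + φ p ^ 2 := by
    intro p; simp only [hφt, hΔφ, hQV]; ring
  rw [hπ]
  simp_rw [hdec]
  have hi1 : Integrable (fun p ↦ -(φ p * φt p)) (μ₀.prod νt) :=
    hint (hφ.continuous.mul hφts.continuous).neg fun p hp ↦ by rw [hφK p hp, zero_mul, neg_zero]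
  have hi2 : Integrable (fun p ↦ -(φ p * Δφ p) + QV p.1 * φ p ^ 2) (μ₀.prod νt) :=
    hint ((hφ.continuous.mul hΔφs.continuous).neg.add ((hQVc.comp continuous_fst).mul (hφ.continuous.pow 2)))
      fun p hp ↦ by rw [hφK p hp]; ring
  have hi0 : Integrable (fun p ↦ φ p ^ 2) (μ₀.prod νt) :=
    hint (hφ.continuous.pow 2) fun p hp ↦ by rw [hφK p hp]; ring
  -- (1) the time term is nonnegative: `∫ₐᵇ −φ ∂ₛφ ds = ½ φ(x, a)²`
  have h1 : 0 ≤ ∫ p, -(φ p * φt p) ∂μ₀.prod νt := by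
    rw [integral_prod _ hi1]
    refine integral_nonneg fun x ↦ ?_
    dsimp only
    have hφx : ∀ s, HasDerivAt (fun s' ↦ φ (x, s')) (φt (x, s)) s := fun s ↦ hasDerivAt_time hφ x s
    have c2 : Continuous fun s ↦ φ (x, s) := (contDiff_slice_time hφ x).continuous
    have c4 : Continuous fun s ↦ φt (x, s) := (contDiff_slice_time hφts x).continuous
    have hE : ∀ s, HasDerivAt (fun s' ↦ φ (x, s') ^ 2) (2 * φ (x, s) * φt (x, s)) s := by
      intro s
      have hsq : (fun s' ↦ φ (x, s') ^ 2) = fun s' ↦ φ (x, s') * φ (x, s') := funext fun s' ↦ by ring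
      rw [hsq]
      exact ((hφx s).fun_mul (hφx s)).congr_deriv (by ring)
    have hcE : Continuous fun s ↦ 2 * φ (x, s) * φt (x, s) := (continuous_const.mul c2).mul c4
    have hFTC : ∫ s in a..b, 2 * φ (x, s) * φt (x, s) = 0 - φ (x, a) ^ 2 := by
      rw [intervalIntegral.integral_eq_sub_of_hasDerivAt (fun s _ ↦ hE s) (hcE.intervalIntegrable a b),
        hφb x b le_rfl]
      ring
    have hI : ∀ (f : ℝ → ℝ), ∫ s, f s ∂νt = ∫ s in a..b, f s := fun f ↦ by
      rw [hνt, intervalIntegral.integral_of_le hab.le, integral_Ioc_eq_integral_Ioo]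
    rw [hI]
    have heq : ∫ s in a..b, -(φ (x, s) * φt (x, s)) = (1 / 2) * φ (x, a) ^ 2 := by
      have : ∀ s, -(φ (x, s) * φt (x, s)) = -(1 / 2) * (2 * φ (x, s) * φt (x, s)) := fun s ↦ by ring
      simp_rw [this]
      rw [intervalIntegral.integral_const_mul, hFTC]
      ring
    rw [heq]
    positivity
  -- (2) the Schrödinger term is nonnegative at each time (the perfect square)
  have h2 : 0 ≤ ∫ p, (-(φ p * Δφ p) + QV p.1 * φ p ^ 2) ∂μ₀.prod νt := by
    rw [integral_prod_symm _ hi2]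
    refine integral_nonneg fun s ↦ ?_
    change (0 : ℝ) ≤ ∫ x, (-(φ (x, s) * Δφ (x, s)) + QV x * φ (x, s) ^ 2) ∂μ₀
    have hcs : HasCompactSupport fun x ↦ φ (x, s) :=
      HasCompactSupport.of_support_subset_isCompact hK fun x hx ↦ by
        by_contra hxK
        exact hx (hφK (x, s) hxK)
    exact integral_schrodingerForm_nonneg hg hV (contMDiff_slice_space hφ s) hcs
  -- (3) assemble
  have hsum : ∫ p, -(φ p * φt p) + (-(φ p * Δφ p) + QV p.1 * φ p ^ 2) + φ p ^ 2 ∂μ₀.prod νt =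
      (∫ p, -(φ p * φt p) ∂μ₀.prod νt) + (∫ p, (-(φ p * Δφ p) + QV p.1 * φ p ^ 2) ∂μ₀.prod νt)
        + ∫ p, φ p ^ 2 ∂μ₀.prod νt := by
    have hi12 : Integrable (fun p ↦ -(φ p * φt p) + (-(φ p * Δφ p) + QV p.1 * φ p ^ 2)) (μ₀.prod νt) :=
      hi1.add hi2
    rw [integral_add hi12 hi0, integral_add hi1 hi2]
  rw [hsum]
  linarith

end Coercivity

end Literature.Geometry.Riemannian.BakryEmeryComplete

end Part2

/-!
## Part 3 — port of `Summits/SmoothPoincare4/SmoothPoincare4/Theorems/EntropyRungNoncompactShrinkerGapHeatHypoellipticNoncompact.lean` (1 declarations kept)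

# Hypoellipticity of the heat operator on a non-compact manifold
(crux `EntropyRung.NoncompactShrinkerGap`, stmt-SmoothPoincare4-10868, line `collapsed-ends-usc`, v13)

Registered stub `helper_hypoelliptic_noncompact`: on a Riemannian manifold `(M, g)` modelled on
`ℝⁿ` (Hausdorff, second countable, `T3`, Borel — NOT compact), a measurable, locally integrable
very weak solution `u` of `∂ₛu = Δ_g u − Qu + G` on `M × T` (`T ⊆ ℝ` open, `Q, G` smooth on
`M × ℝ`, test functions smooth with compact support in `M × T`) agrees a.e. with a function
smooth on `M × T`.

The tree proves this for CLOSED `M` and time-dependent metrics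
(`exists_contMDiffOn_ae_eq_of_linearHeat_veryWeak`, `LinearHeatWeakRegularity.lean`), using
compactness only to synthesise `T3` and `SFinite dV_{g₀}`. Here the argument is re-run verbatim
with `[T3Space M] [SecondCountableTopology M]`: in each space-time chart the representative is a
very weak solution of a parabolic equation with smooth coefficients
(`integral_heatTranspose_chart_of_veryWeak_nc`), hence locally a.e. smooth by Hörmander's
theorem in coordinates (`exists_contDiffOn_ae_eq_of_heat_veryWeak`, from
`hormander1967_thm11_proof`); local representatives are pulled back
(`ae_prod_chart_of_ae_volume_nc`) and patched (`exists_contMDiffOn_ae_eq_of_forall_exists_nhds`).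
The static statement is the constant family `h ≡ g`, `g₀ = g`, whose density ratio is `1`.

## References

* L. Hörmander, *Hypoelliptic second order differential equations*, Acta Math. 119 (1967)
  147–171, Thm 1.1 and p. 147. [Hormander1967]
* I. Chavel, *Riemannian Geometry: A Modern Introduction*, 2nd ed., CUP 2006, §III.3, §III.7.
  [Chavel2006]
-/

section Part3

open _root_.Bundle _root_.Set _root_.Function _root_.Filter _root_.MeasureTheory Measure _root_.TopologicalSpace
open scoped _root_.Manifold _root_.ContDiff _root_.Topology _root_.Matrix _root_.ENNReal
open Literature.Geometry.Riemannian Literature.Geometry.Lorentzian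
  Literature.Geometry.Lorentzian.PseudoRiemannianMetric Literature.Analysis.Distribution

namespace Literature.Geometry.Riemannian.NoncompactShrinkerGapHeat

section Regularity

variable {m : ℕ} {H : Type*} [TopologicalSpace H]
  {I : ModelWithCorners ℝ (EuclideanSpace ℝ (Fin m)) H}
  {M : Type*} [TopologicalSpace M] [ChartedSpace H M]
  [IsManifold I ∞ M] [I.Boundaryless] [T3Space M] [SecondCountableTopology M]
  [MeasurableSpace M] [BorelSpace M]
  {h : ℝ → PseudoRiemannianMetric I ∞ (EuclideanSpace ℝ (Fin m)) (TangentSpace I : M → Type _)}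
  {g₀ : PseudoRiemannianMetric I ∞ (EuclideanSpace ℝ (Fin m)) (TangentSpace I : M → Type _)}

end Regularity

/-- **Hypoellipticity of the heat operator on a non-compact manifold, static metric.** Let
`(M, g)` be a Riemannian manifold modelled on `ℝⁿ` (Hausdorff, second countable, `T3`, Borel;
NOT assumed compact), `Q, G` smooth on `M × ℝ`, `T ⊆ ℝ` open, and let `u : M × ℝ → ℝ` be
measurable, locally integrable on `M × T` for `dV_g ⊗ ds`, and a very weak solution of
`∂ₛu = Δ_g u − Qu + G`: `∫ u (−∂ₛζ − Δ_g ζ + Qζ) = ∫ Gζ` for every smooth `ζ` compactly supported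
in `M × T`. Then `u` agrees a.e. on `M × T` with a function smooth on `M × T`. This is
`exists_contMDiffOn_ae_eq_of_linearHeat_veryWeak_nc` for the constant family `h ≡ g`, `g₀ = g`
(density ratio `≡ 1` since `♯ ∘ ♭ = id`). [cite: Hormander1967, Thm 1.1 and p. 147] -/
theorem helper_hypoelliptic_noncompact : ∀ (n : ℕ) (M : Type*) [TopologicalSpace M] [T2Space M] [SecondCountableTopology M] [ChartedSpace (EuclideanSpace ℝ (Fin n)) M] [IsManifold (𝓡 n) ∞ M] [T3Space M] [MeasurableSpace M] [BorelSpace M] (g : PseudoRiemannianMetric (𝓡 n) ∞ (EuclideanSpace ℝ (Fin n)) (TangentSpace (𝓡 n) : M → Type _)), g.IsRiemannian → ∀ (Q G : ℝ → M → ℝ), ContMDiff ((𝓡 n).prod 𝓘(ℝ, ℝ)) 𝓘(ℝ, ℝ) ∞ (fun p : M × ℝ ↦ Q p.2 p.1) → ContMDiff ((𝓡 n).prod 𝓘(ℝ, ℝ)) 𝓘(ℝ, ℝ) ∞ (fun p : M × ℝ ↦ G p.2 p.1) → ∀ (T : Set ℝ) (u : M × ℝ → ℝ), IsOpen T → Measurable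 u → LocallyIntegrableOn u (univ ×ˢ T) (g.riemVolume.prod (volume : Measure ℝ)) → (∀ ζ : M × ℝ → ℝ, ContMDiff ((𝓡 n).prod 𝓘(ℝ, ℝ)) 𝓘(ℝ, ℝ) ∞ ζ → HasCompactSupport ζ → tsupport ζ ⊆ univ ×ˢ T → ∫ p, u p * (-(deriv (fun s ↦ ζ (p.1, s)) p.2) - g.laplaceBeltrami (fun x ↦ ζ (x, p.2)) p.1 + Q p.2 p.1 * ζ p) ∂(g.riemVolume.prod (volume : Measure ℝ)) = ∫ p, G p.2 p.1 * ζ p ∂(g.riemVolume.prod (volume : Measure ℝ))) → ∃ v : M × ℝ → ℝ, ContMDiffOn ((𝓡 n).prod 𝓘(ℝ, ℝ)) 𝓘(ℝ, ℝ) ∞ v (univ ×ˢ T) ∧ ∀ᵐ p ∂(g.riemVolume.prod (volume : Measure ℝ)), p ∈ univ ×ˢ T → u p = v p := by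
  intro n M _ _ _ _ _ _ _ _ g hg Q G hQ hG T u hT hum hu hweak
  -- the density ratio of `g` with respect to itself is `1` (`♯ ∘ ♭ = id`, `det id = 1`)
  have hρ1 : ∀ x : M, g.densityRatio g x = 1 := fun x ↦ by
    have hid : (g.sharp x).toLinearMap ∘ₗ g.flat x = LinearMap.id := by
      apply LinearMap.ext
      intro v
      simp only [LinearMap.coe_comp, comp_apply, LinearMap.id_coe, id_eq, LinearEquiv.coe_coe]
      exact g.sharp_flat x v
    rw [densityRatio_def, hid, LinearMap.det_id, Real.sqrt_one]
  refine exists_contMDiffOn_ae_eq_of_linearHeat_veryWeak_nc (h := fun _ ↦ g) (g₀ := g)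
    (isContMDiffFamilyOn_const g univ) (fun _ ↦ hg) hg hQ hG hT hum hu ?_
  intro ζ hζ hζc hζT
  simp only [hρ1, one_mul]
  exact hweak ζ hζ hζc hζT

end Literature.Geometry.Riemannian.NoncompactShrinkerGapHeat

end Part3

/-!
## Part 4 — port of `Summits/SmoothPoincare4/SmoothPoincare4/Theorems/EntropyRungNoncompactShrinkerGapHeatClassicalNoncompact.lean` (3 declarations kept)

# Smooth very weak solutions of the static linear heat equation on a complete manifold are classical

Helper `helper_classicalOfVeryWeak_noncompact` of the registered stub `stub_compactSupportLSI`: the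
non-compact, static-metric version of `linearHeat_classical_of_veryWeak_of_contMDiffOn`
(`LinearHeatVeryWeakClassical.lean`, written for a closed manifold and a time-dependent family with its
density ratio). Let `(M, g)` be a Riemannian manifold modelled on `ℝⁿ` (Hausdorff, second countable, `T₃`
— NOT compact), `Q, G` smooth on `M × ℝ`, `T ⊆ ℝ` open and `v` smooth on `M × T` with
`∫ v (−∂ₛζ − Δ_g ζ(·, s) + Qζ) d(V_g ⊗ ds) = ∫ G ζ d(V_g ⊗ ds)` for every smooth compactly supported `ζ`
with `tsupport ζ ⊆ M × T`. Then `∂ₛv − Δ_g v(·, s) + Q v = G` pointwise on `M × T`.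

Proof (as in the tree, the three compactness uses replaced): `V_g` is finite on compact sets
(`isFiniteMeasureOnCompacts_riemVolume`), hence σ-finite on the second countable, locally compact `M`
(Fubini); integration by parts in time is the compactly supported one on `ℝ`
(`integral_mul_deriv_eq_neg_of_tsupport_subset`); Green's identity in space is the one for a compactly
supported factor on a non-compact manifold (`GreenIdentityCompactSupport.lean`, both
`…_of_hasCompactSupport` and `…_of_hasCompactSupport_right`, applied to the slices `v(·, σ) ∈ C^∞` and
`ζ(·, σ) ∈ C^∞_c`); the conclusion is the fundamental lemma of the calculus of variations on the manifold
`M × ℝ` (`eqOn_zero_of_forall_integral_mul_contMDiff_eq_zero`). Everything is proved; no definitions.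

References: L. C. Evans, *Partial differential equations*, 2nd ed. (2010), §7.1.1; J. M. Lee,
*Introduction to Riemannian manifolds*, 2nd ed. (2018), Problem 2-23 (a).
-/

section Part4

open scoped _root_.Manifold _root_.ContDiff _root_.ENNReal _root_.NNReal _root_.Topology
open _root_.MeasureTheory _root_.Set _root_.Filter
open Literature.Geometry.Lorentzian Literature.Geometry.Riemannian

namespace Literature.Geometry.Riemannian.NoncompactShrinkerGapHeat

section ClassicalStatic

variable {n : ℕ} {M : Type*} [TopologicalSpace M] [T2Space M] [SecondCountableTopology M]
  [ChartedSpace (EuclideanSpace ℝ (Fin n)) M] [IsManifold (𝓡 n) ∞ M] [T3Space M] [MeasurableSpace M]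
  [BorelSpace M]
  {g : PseudoRiemannianMetric (𝓡 n) ∞ (EuclideanSpace ℝ (Fin n)) (TangentSpace (𝓡 n) : M → Type _)}

omit [SecondCountableTopology M] [ChartedSpace (EuclideanSpace ℝ (Fin n)) M] [IsManifold (𝓡 n) ∞ M]
  [T3Space M] [MeasurableSpace M] [BorelSpace M] [T2Space M] in
/-- A function continuous on an open set times a continuous function supported inside that set is
continuous on the whole space. [folklore] -/
private theorem continuous_mul_of_continuousOn_of_tsupport_subset_cs {X : Type*} [TopologicalSpace X]
    {O : Set X} (hO : IsOpen O) {E k : X → ℝ} (hE : ContinuousOn E O) (hk : Continuous k)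
    (hkO : tsupport k ⊆ O) : Continuous fun p ↦ E p * k p := by
  refine continuous_of_tsupport fun p hp ↦ ?_
  have hpO : p ∈ O := hkO (tsupport_mul_subset_right hp)
  exact ((hE.continuousWithinAt hpO).continuousAt (hO.mem_nhds hpO)).mul hk.continuousAt

/-- **Smooth very weak solutions of `∂ₛv − Δ_g v + Q v = G` on a complete manifold are classical
solutions.** `(M, g)` Riemannian modelled on `ℝⁿ` (Hausdorff, second countable, `T₃`, NOT compact), `Q, G`
smooth on `M × ℝ`, `T` open, `v` smooth on `M × T` with
`∫ v (−∂ₛζ − Δ_g ζ(·, s) + Qζ) d(V_g ⊗ ds) = ∫ G ζ d(V_g ⊗ ds)` for all smooth compactly supported `ζ`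
with `tsupport ζ ⊆ M × T`; then `∂ₛv − Δ_g v(·, s) + Qv = G` on `M × T` (integration by parts in time,
Green's identity with a compactly supported factor in space, Fubini for the σ-finite `V_g`, and the
fundamental lemma of the calculus of variations). [cite: Evans2010, §7.1.1] -/
theorem linearHeat_classical_of_veryWeak_static (hg : g.IsRiemannian) {Q G : ℝ → M → ℝ}
    (hQ : ContMDiff ((𝓡 n).prod 𝓘(ℝ, ℝ)) 𝓘(ℝ, ℝ) ∞ fun p : M × ℝ ↦ Q p.2 p.1)
    (hG : ContMDiff ((𝓡 n).prod 𝓘(ℝ, ℝ)) 𝓘(ℝ, ℝ) ∞ fun p : M × ℝ ↦ G p.2 p.1)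
    {T : Set ℝ} (hT : IsOpen T) {v : M × ℝ → ℝ}
    (hv : ContMDiffOn ((𝓡 n).prod 𝓘(ℝ, ℝ)) 𝓘(ℝ, ℝ) ∞ v (univ ×ˢ T))
    (hweak : ∀ ζ : M × ℝ → ℝ, ContMDiff ((𝓡 n).prod 𝓘(ℝ, ℝ)) 𝓘(ℝ, ℝ) ∞ ζ → HasCompactSupport ζ →
      tsupport ζ ⊆ univ ×ˢ T →
      ∫ p, v p * (-(deriv (fun s ↦ ζ (p.1, s)) p.2) - g.laplaceBeltrami (fun x ↦ ζ (x, p.2)) p.1 +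
          Q p.2 p.1 * ζ p) ∂(g.riemVolume.prod (volume : Measure ℝ)) =
        ∫ p, G p.2 p.1 * ζ p ∂(g.riemVolume.prod (volume : Measure ℝ))) :
    ∀ p ∈ univ ×ˢ T, deriv (fun s ↦ v (p.1, s)) p.2 -
      g.laplaceBeltrami (fun x ↦ v (x, p.2)) p.1 + Q p.2 p.1 * v p = G p.2 p.1 := by
  classical
  have h1le : (1 : ℕ∞ω) ≤ (∞ : ℕ∞ω) := WithTop.coe_le_coe.mpr le_top
  have h2le : (2 : ℕ∞ω) ≤ (∞ : ℕ∞ω) := WithTop.coe_le_coe.mpr le_top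
  -- topology and the reference measure (finite on compact sets, σ-finite, positive on open sets)
  haveI : LocallyCompactSpace M := ChartedSpace.locallyCompactSpace (EuclideanSpace ℝ (Fin n)) M
  set μ₀ : Measure M := g.riemVolume with hμ₀
  haveI : IsFiniteMeasureOnCompacts μ₀ := CarrilloNi2009_shrinkerLSI.isFiniteMeasureOnCompacts_riemVolume hg
  haveI : μ₀.IsOpenPosMeasure := by
    rw [hμ₀, PseudoRiemannianMetric.riemVolume_eq hg]
    exact isOpenPosMeasure_riemannianMeasure _
  haveI : (μ₀.prod (volume : Measure ℝ)).IsOpenPosMeasure := Measure.prod.instIsOpenPosMeasure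
  have hO : IsOpen ((univ : Set M) ×ˢ T) := isOpen_univ.prod hT
  have hfam : IsContMDiffFamilyOn ∞ (fun _ : ℝ ↦ g) univ := isContMDiffFamilyOn_const g univ
  -- continuity data of `v`: `v`, `∂ₛv`, `Δv` on `M × T`; slices
  have hvc : ContinuousOn v (univ ×ˢ T) := hv.continuousOn
  have hDv : ContinuousOn (fun p : M × ℝ ↦ deriv (fun s ↦ v (p.1, s)) p.2) (univ ×ˢ T) := by
    have h1 := Literature.Geometry.Manifold.contMDiffOn_derivWithin_time (I := 𝓡 n)
      (u := fun s x ↦ v (x, s)) hT.uniqueDiffOn hv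
    refine h1.continuousOn.congr fun p hp ↦ ?_
    simp only
    rw [derivWithin_of_isOpen hT hp.2]
  have hLv : ContinuousOn (fun p : M × ℝ ↦ g.laplaceBeltrami (fun x ↦ v (x, p.2)) p.1) (univ ×ˢ T) :=
    ((hfam.mono (subset_univ T)).contMDiffOn_laplaceBeltrami hT.uniqueDiffOn
      (f := fun s x ↦ v (x, s)) hv).continuousOn
  have hvslice : ∀ σ ∈ T, ContMDiff (𝓡 n) 𝓘(ℝ, ℝ) ∞ fun x ↦ v (x, σ) := fun σ hσ ↦
    hv.comp_contMDiff (contMDiff_id.prodMk contMDiff_const) fun x ↦ ⟨mem_univ _, hσ⟩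
  have hvderiv : ∀ y, ∀ σ ∈ T, HasDerivAt (fun s ↦ v (y, s)) (deriv (fun s ↦ v (y, s)) σ) σ := by
    intro y σ hσ
    have h1 : ContMDiffAt ((𝓡 n).prod 𝓘(ℝ, ℝ)) 𝓘(ℝ, ℝ) ∞ v (y, σ) :=
      (hv _ ⟨mem_univ _, hσ⟩).contMDiffAt (hO.mem_nhds ⟨mem_univ _, hσ⟩)
    have h2 : ContMDiffAt 𝓘(ℝ, ℝ) 𝓘(ℝ, ℝ) ∞ (fun s ↦ v (y, s)) σ :=
      h1.comp σ (contMDiffAt_const.prodMk contMDiffAt_id)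
    exact (h2.contDiffAt.differentiableAt (by simp)).hasDerivAt
  -- the continuous function which will be shown to vanish
  set W : M × ℝ → ℝ := fun p ↦ deriv (fun s ↦ v (p.1, s)) p.2 -
    g.laplaceBeltrami (fun x ↦ v (x, p.2)) p.1 + Q p.2 p.1 * v p - G p.2 p.1 with hW
  have hWc : ContinuousOn W (univ ×ˢ T) :=
    ((hDv.sub hLv).add (hQ.continuous.continuousOn.mul hvc)).sub hG.continuous.continuousOn
  suffices hW0 : ∀ p ∈ univ ×ˢ T, W p = 0 by
    intro p hp
    have h1 := hW0 p hp
    rw [hW] at h1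
    simp only at h1
    linarith
  refine eqOn_zero_of_forall_integral_mul_contMDiff_eq_zero (J := (𝓡 n).prod 𝓘(ℝ, ℝ))
    (μ₀.prod (volume : Measure ℝ)) hO hWc fun ζ hζ hζc hζT _ ↦ ?_
  /- the identity `∫ W ζ = 0` for a test function `ζ` -/
  have hζc' : Continuous ζ := hζ.continuous
  have hζslice : ∀ σ, ContMDiff (𝓡 n) 𝓘(ℝ, ℝ) ∞ fun x ↦ ζ (x, σ) := fun σ ↦
    hζ.comp (contMDiff_id.prodMk contMDiff_const)
  have hζzero : ∀ p, p ∉ tsupport ζ → ζ =ᶠ[𝓝 p] 0 := fun p hp ↦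
    notMem_tsupport_iff_eventuallyEq.1 hp
  have hζT' : ∀ σ, σ ∉ T → ∀ y, ζ (y, σ) = 0 := fun σ hσ y ↦
    image_eq_zero_of_notMem_tsupport fun hm ↦ hσ (hζT hm).2
  -- the time derivative `kt` and the space term `kx`
  set kt : M × ℝ → ℝ := fun p ↦ deriv (fun s ↦ ζ (p.1, s)) p.2 with hkt
  have hktc : Continuous kt := (contMDiff_deriv_time hζ).continuous
  have hktsupp : Function.support kt ⊆ tsupport ζ := by
    intro p hp
    by_contra hnot
    have e0 : (fun s ↦ ζ (p.1, s)) =ᶠ[𝓝 p.2] fun _ ↦ (0 : ℝ) := by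
      have e1 := eventuallyEq_zero_comp_of_eventuallyEq_zero (ι := fun s : ℝ ↦ ((p.1, s) : M × ℝ))
        (continuous_const.prodMk continuous_id) (y := p.2) (hζzero p hnot)
      filter_upwards [e1] with s hs
      simpa only [Pi.zero_apply] using hs
    refine hp ?_
    rw [hkt]
    simp only
    rw [e0.deriv_eq]
    exact deriv_const p.2 0
  have hktT : tsupport kt ⊆ univ ×ˢ T :=
    (closure_minimal hktsupp (isClosed_tsupport ζ)).trans hζT
  have hktcs : HasCompactSupport kt := hζc.mono' hktsupp
  set kx : M × ℝ → ℝ := fun p ↦ g.laplaceBeltrami (fun x ↦ ζ (x, p.2)) p.1 with hkx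
  have hkxc : Continuous kx := (contMDiff_laplaceBeltrami_family hfam hζ).continuous
  have hkxsupp : Function.support kx ⊆ tsupport ζ := by
    intro p hp
    by_contra hnot
    have e0 : (fun x ↦ ζ (x, p.2)) =ᶠ[𝓝 p.1] fun _ ↦ (0 : ℝ) :=
      eventuallyEq_zero_comp_of_eventuallyEq_zero (ι := fun x : M ↦ ((x, p.2) : M × ℝ))
        (continuous_id.prodMk continuous_const) (y := p.1) (hζzero p hnot)
    refine hp ?_
    rw [hkx]
    simp only
    rw [laplaceBeltrami_eq_zero_of_eventuallyEq_zero _ e0]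
  have hkxT : tsupport kx ⊆ univ ×ˢ T :=
    (closure_minimal hkxsupp (isClosed_tsupport ζ)).trans hζT
  have hkxcs : HasCompactSupport kx := hζc.mono' hkxsupp
  -- integrability of the space-time integrands
  have hI1 : Integrable (fun p ↦ v p * kt p) (μ₀.prod (volume : Measure ℝ)) :=
    (continuous_mul_of_continuousOn_of_tsupport_subset_cs hO hvc hktc hktT)
      |>.integrable_of_hasCompactSupport hktcs.mul_left
  have hI2 : Integrable (fun p : M × ℝ ↦ deriv (fun s ↦ v (p.1, s)) p.2 * ζ p)
      (μ₀.prod (volume : Measure ℝ)) :=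
    (continuous_mul_of_continuousOn_of_tsupport_subset_cs hO hDv hζc' hζT)
      |>.integrable_of_hasCompactSupport hζc.mul_left
  have hI3 : Integrable (fun p ↦ v p * kx p) (μ₀.prod (volume : Measure ℝ)) :=
    (continuous_mul_of_continuousOn_of_tsupport_subset_cs hO hvc hkxc hkxT)
      |>.integrable_of_hasCompactSupport hkxcs.mul_left
  have hI4 : Integrable (fun p : M × ℝ ↦ g.laplaceBeltrami (fun x ↦ v (x, p.2)) p.1 * ζ p)
      (μ₀.prod (volume : Measure ℝ)) :=
    (continuous_mul_of_continuousOn_of_tsupport_subset_cs hO hLv hζc' hζT)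
      |>.integrable_of_hasCompactSupport hζc.mul_left
  have hI5 : Integrable (fun p : M × ℝ ↦ v p * (Q p.2 p.1 * ζ p)) (μ₀.prod (volume : Measure ℝ)) := by
    have hs : tsupport (fun p : M × ℝ ↦ Q p.2 p.1 * ζ p) ⊆ univ ×ˢ T :=
      (tsupport_mul_subset_right).trans hζT
    exact (continuous_mul_of_continuousOn_of_tsupport_subset_cs hO hvc (hQ.continuous.mul hζc')
      hs).integrable_of_hasCompactSupport hζc.mul_left.mul_left
  have hI6 : Integrable (fun p : M × ℝ ↦ G p.2 p.1 * ζ p) (μ₀.prod (volume : Measure ℝ)) :=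
    (hG.continuous.mul hζc').integrable_of_hasCompactSupport hζc.mul_left
  -- (I-t) integration by parts in time
  have hIt : ∫ p, v p * kt p ∂μ₀.prod (volume : Measure ℝ) =
      -∫ p : M × ℝ, deriv (fun s ↦ v (p.1, s)) p.2 * ζ p ∂μ₀.prod (volume : Measure ℝ) := by
    rw [integral_prod _ hI1, integral_prod _ hI2, ← integral_neg]
    refine integral_congr_ae (Eventually.of_forall fun y ↦ ?_)
    simp only
    obtain ⟨hkyc, hkyT⟩ := hasCompactSupport_slice_time hζc y hζT
    have hky : ContDiff ℝ 1 fun s ↦ ζ (y, s) := (contDiff_slice_time hζ y).of_le h1le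
    have hwc : ContinuousOn (fun s ↦ v (y, s)) T :=
      hvc.comp (continuous_const.prodMk continuous_id).continuousOn fun s hs ↦ ⟨mem_univ _, hs⟩
    have hw'c : ContinuousOn (fun s ↦ deriv (fun s' ↦ v (y, s')) s) T :=
      hDv.comp (continuous_const.prodMk continuous_id).continuousOn fun s hs ↦ ⟨mem_univ _, hs⟩
    exact integral_mul_deriv_eq_neg_of_tsupport_subset hT hwc hw'c (hvderiv y) hky hkyc hkyT
  -- (I-x) Green's identity in space (one factor compactly supported)
  have hIx : ∫ p, v p * kx p ∂μ₀.prod (volume : Measure ℝ) =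
      ∫ p : M × ℝ, g.laplaceBeltrami (fun x ↦ v (x, p.2)) p.1 * ζ p ∂μ₀.prod (volume : Measure ℝ) := by
    rw [integral_prod_symm _ hI3, integral_prod_symm _ hI4]
    refine integral_congr_ae (Eventually.of_forall fun σ ↦ ?_)
    simp only
    by_cases hσ : σ ∈ T
    · have hcomm := integral_mul_laplaceBeltrami_comm_of_hasCompactSupport_cs hg
        ((hvslice σ hσ).of_le h2le) ((hζslice σ).of_le h2le) (hasCompactSupport_slice_space_cs hζc σ)
      rw [hkx]
      refine hcomm.trans (integral_congr_ae (Eventually.of_forall fun y ↦ ?_))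
      simp only
      ring
    · have hz : (fun x ↦ ζ (x, σ)) = fun _ ↦ (0 : ℝ) := funext fun y ↦ hζT' σ hσ y
      refine integral_congr_ae (Eventually.of_forall fun y ↦ ?_)
      rw [hkx]
      simp only
      rw [hz, laplaceBeltrami_fun_zero, hζT' σ hσ y]
      ring
  -- assemble
  have hw := hweak ζ hζ hζc hζT
  have hlhs : ∫ p, v p * (-(deriv (fun s ↦ ζ (p.1, s)) p.2) -
      g.laplaceBeltrami (fun x ↦ ζ (x, p.2)) p.1 + Q p.2 p.1 * ζ p) ∂μ₀.prod (volume : Measure ℝ) =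
      -∫ p, v p * kt p ∂μ₀.prod (volume : Measure ℝ) - ∫ p, v p * kx p ∂μ₀.prod (volume : Measure ℝ)
        + ∫ p : M × ℝ, v p * (Q p.2 p.1 * ζ p) ∂μ₀.prod (volume : Measure ℝ) := by
    have e1 : ∫ p, v p * (-(deriv (fun s ↦ ζ (p.1, s)) p.2) -
        g.laplaceBeltrami (fun x ↦ ζ (x, p.2)) p.1 + Q p.2 p.1 * ζ p) ∂μ₀.prod (volume : Measure ℝ) =
        ∫ p : M × ℝ, ((-(v p * kt p) - v p * kx p) + v p * (Q p.2 p.1 * ζ p))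
          ∂μ₀.prod (volume : Measure ℝ) := by
      refine integral_congr_ae (Eventually.of_forall fun p ↦ ?_)
      rw [hkt, hkx]
      simp only
      ring
    have hA : Integrable (fun p : M × ℝ ↦ -(v p * kt p) - v p * kx p)
        (μ₀.prod (volume : Measure ℝ)) := hI1.fun_neg.sub hI3
    have hB : Integrable (fun p : M × ℝ ↦ -(v p * kt p)) (μ₀.prod (volume : Measure ℝ)) :=
      hI1.fun_neg
    rw [e1, integral_add hA hI5, integral_sub hB hI3, integral_neg]
  rw [hlhs, hIt, hIx, neg_neg] at hw
  -- `∫ W ζ = (∫ ∂v ζ) - (∫ Δv ζ) + (∫ v Q ζ) - ∫ G ζ = 0`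
  have hWζ : ∫ p, W p * ζ p ∂μ₀.prod (volume : Measure ℝ) =
      ∫ p : M × ℝ, deriv (fun s ↦ v (p.1, s)) p.2 * ζ p ∂μ₀.prod (volume : Measure ℝ)
      - ∫ p : M × ℝ, g.laplaceBeltrami (fun x ↦ v (x, p.2)) p.1 * ζ p ∂μ₀.prod (volume : Measure ℝ)
      + ∫ p : M × ℝ, v p * (Q p.2 p.1 * ζ p) ∂μ₀.prod (volume : Measure ℝ)
      - ∫ p : M × ℝ, G p.2 p.1 * ζ p ∂μ₀.prod (volume : Measure ℝ) := by
    have e2 : ∫ p, W p * ζ p ∂μ₀.prod (volume : Measure ℝ) =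
        ∫ p : M × ℝ, (((deriv (fun s ↦ v (p.1, s)) p.2 * ζ p
          - g.laplaceBeltrami (fun x ↦ v (x, p.2)) p.1 * ζ p)
          + v p * (Q p.2 p.1 * ζ p)) - G p.2 p.1 * ζ p) ∂μ₀.prod (volume : Measure ℝ) := by
      refine integral_congr_ae (Eventually.of_forall fun p ↦ ?_)
      rw [hW]
      simp only
      ring
    have hA : Integrable (fun p : M × ℝ ↦ deriv (fun s ↦ v (p.1, s)) p.2 * ζ p
        - g.laplaceBeltrami (fun x ↦ v (x, p.2)) p.1 * ζ p) (μ₀.prod (volume : Measure ℝ)) :=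
      hI2.sub hI4
    have hB : Integrable (fun p : M × ℝ ↦ (deriv (fun s ↦ v (p.1, s)) p.2 * ζ p
        - g.laplaceBeltrami (fun x ↦ v (x, p.2)) p.1 * ζ p) + v p * (Q p.2 p.1 * ζ p))
        (μ₀.prod (volume : Measure ℝ)) := hA.add hI5
    rw [e2, integral_sub hB hI6, integral_add hA hI5, integral_sub hI2 hI4]
  rw [hWζ]
  linarith [hw]

end ClassicalStatic

/-- **Registered helper `helper_classicalOfVeryWeak_noncompact`** (line `collapsed-ends-usc`): a function
`v` smooth on `M × T` (`T` open) which solves the static linear heat equation `∂ₛv − Δ_g v + Qv = G` in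
the very weak sense against all smooth compactly supported test functions supported in `M × T`, on a
(non-compact) Riemannian manifold `(M, g)` modelled on `ℝⁿ`, solves it pointwise on `M × T`
(`linearHeat_classical_of_veryWeak_static`). [cite: Evans2010, §7.1.1] -/
theorem helper_classicalOfVeryWeak_noncompact : ∀ (n : ℕ) (M : Type*) [TopologicalSpace M] [T2Space M] [SecondCountableTopology M] [ChartedSpace (EuclideanSpace ℝ (Fin n)) M] [IsManifold (𝓡 n) ∞ M] [T3Space M] [MeasurableSpace M] [BorelSpace M] (g : PseudoRiemannianMetric (𝓡 n) ∞ (EuclideanSpace ℝ (Fin n)) (TangentSpace (𝓡 n) : M → Type _)), g.IsRiemannian → ∀ (Q G : ℝ → M → ℝ), ContMDiff ((𝓡 n).prod 𝓘(ℝ, ℝ)) 𝓘(ℝ, ℝ) ∞ (fun p : M × ℝ ↦ Q p.2 p.1) → ContMDiff ((𝓡 n).prod 𝓘(ℝ, ℝ)) 𝓘(ℝ, ℝ) ∞ (fun p : M × ℝ ↦ G p.2 p.1) → ∀ (T : Set ℝ) (v : M × ℝ → ℝ), IsOpen T → ContMDiffOn ((𝓡 n).prod 𝓘(ℝ, ℝ))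 𝓘(ℝ, ℝ) ∞ v (univ ×ˢ T) → (∀ ζ : M × ℝ → ℝ, ContMDiff ((𝓡 n).prod 𝓘(ℝ, ℝ)) 𝓘(ℝ, ℝ) ∞ ζ → HasCompactSupport ζ → tsupport ζ ⊆ univ ×ˢ T → ∫ p, v p * (-(deriv (fun s ↦ ζ (p.1, s)) p.2) - g.laplaceBeltrami (fun x ↦ ζ (x, p.2)) p.1 + Q p.2 p.1 * ζ p) ∂(g.riemVolume.prod (volume : Measure ℝ)) = ∫ p, G p.2 p.1 * ζ p ∂(g.riemVolume.prod (volume : Measure ℝ))) → ∀ p ∈ univ ×ˢ T, deriv (fun s ↦ v (p.1, s)) p.2 - g.laplaceBeltrami (fun x ↦ v (x, p.2)) p.1 + Q p.2 p.1 * v p = G p.2 p.1 := by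
  intro n M _ _ _ _ _ _ _ _ g hg Q G hQ hG T v hT hv hweak
  exact linearHeat_classical_of_veryWeak_static hg hQ hG hT hv hweak

end Literature.Geometry.Riemannian.NoncompactShrinkerGapHeat

end Part4

/-!
## Part 5 — port of `Summits/SmoothPoincare4/SmoothPoincare4/Theorems/EntropyRungBakryEmeryLogSobolevForcing.lean` (2 declarations kept)

# The forced ground-state transformed heat problem on a complete weighted manifold with ARBITRARY smooth
# weight: smooth solutions vanishing for `s ≤ 0`

Setting: `M` modelled on `ℝⁿ` (Hausdorff, second countable, `T₃`, Borel — NOT compact), `g` Riemannian with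
its Levi-Civita connection, `V` smooth (NO further assumption), the ground-state potential
`Q = ¼|∇V|² − ½Δ_gV + 1` (unbounded below in general), and Gaffney cut-offs `η_k` (`0 ≤ η_k ≤ 1`,
`η_k ≤ η_{k+1}`, `η_k(x) = 1` for large `k`, `|∇η_k|² ≤ C₀/(k+1)²`, `exists_gaffney_cutoff`).

* `exists_smooth_schrodingerHeat_forcing` — for `G` smooth with compact support in `M × ℝ` and `G = 0` for
  `s ≤ 0`, there is `v` smooth on `M × (−∞, b)` with `v = 0` for `s ≤ 0`, `∂ₛv = Δ_g v − Qv + G` on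
  `M × (−∞, b)` and `v² ∈ L¹(M × (0, b))`. This is the shrinker toolkit's
  `exists_smooth_linearHeat_forcing_static` (`EntropyRungNoncompactShrinkerGapHeatLinearHeat.lean`, crux
  `EntropyRung.NoncompactShrinkerGap`; Trèves 1975, §41) with its two uses of `Q ≥ 1` / Laplacian cut-offs
  replaced: Lions' very weak solution now comes from the perfect-square energy inequality
  (`exists_veryWeak_linearHeat_of_energyIneq` + `energy_le_integral_mul_schrodingerAdjoint`), and the
  vanishing on `[−3, 0]` from the weighted `L²` maximum principle with FIRST-ORDER cut-offs
  (`gaffney_maxPrinciple`) applied to `± e^{V/2} e^{s} v(·, s − 3)`, a solution of the weighted heat equation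
  `∂ₛz = Lz` (`heatDrift_of_potential`); hypoellipticity (`helper_hypoelliptic_noncompact`) and the
  classical equation (`helper_classicalOfVeryWeak_noncompact`) are the toolkit's, unchanged;
* `linearHeat_cauchy_gaffney` — the linear Cauchy problem `∂ₛw = Δ_g w − Qw`, `w(0) = W(0)` for
  flat-corrector data `(W, G, K)` (as produced by `helper_flatCorrector_noncompact`): a solution smooth on
  `M × (−∞, T+1)`, square integrable on `M × (0, T)` — `helper_linearHeat_noncompact` in this setting.

Everything is proved; no definitions, no named facts.

## References

* [Treves1975] F. Trèves, *Basic Linear Partial Differential Equations* (1975), §41, Thm. 40.1.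
* [Grigoryan2009] A. Grigor'yan (2009), Ch. 7–8 and §11.4 (uniqueness class of the Cauchy problem).
* [BakryGentilLedoux2014] D. Bakry, I. Gentil, M. Ledoux (2014), §3.2 (pp. 141–147).
-/

section Part5

open scoped _root_.Manifold _root_.ContDiff _root_.ENNReal _root_.NNReal _root_.Topology
open _root_.MeasureTheory _root_.Set _root_.Filter
open Literature.Geometry.Lorentzian Literature.Geometry.Riemannian
open Literature.Geometry.Lorentzian.PseudoRiemannianMetric (laplaceBeltrami_eq_dalembertian)

namespace Literature.Geometry.Riemannian.BakryEmeryComplete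

open NoncompactShrinkerGapHeat

/-- **Time translation of strip integrability**: if `F` is integrable on `M × (a, b')` for `μ ⊗ ds`, then
`(x, r) ↦ F (x, r − c)` is integrable on `M × (a + c, b' + c)` (Lebesgue measure is translation invariant;
`MeasurePreserving.integrableOn_comp_preimage` for the shear `Prod.map id (· − c)`). [cite: Treves1975, §41, Thm. 40.1] -/
theorem integrable_strip_comp_sub {X : Type*} [MeasurableSpace X] (μ : Measure X) [SFinite μ] {F : X × ℝ → ℝ}
    {a b' : ℝ} (c : ℝ)
    (hF : Integrable F ((μ.prod (volume : Measure ℝ)).restrict (univ ×ˢ Ioo a b'))) :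
    Integrable (fun p : X × ℝ ↦ F (p.1, p.2 - c))
      ((μ.prod (volume : Measure ℝ)).restrict (univ ×ˢ Ioo (a + c) (b' + c))) := by
  have hmp : MeasurePreserving (Prod.map (id : X → X) (fun t : ℝ ↦ t - c))
      (μ.prod (volume : Measure ℝ)) (μ.prod (volume : Measure ℝ)) :=
    (MeasurePreserving.id μ).prod (measurePreserving_sub_right volume c)
  have hme : MeasurableEmbedding (Prod.map (id : X → X) (fun t : ℝ ↦ t - c)) :=
    ((MeasurableEquiv.refl X).prodCongr (MeasurableEquiv.subRight c)).measurableEmbedding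
  have hpre : (Prod.map (id : X → X) (fun t : ℝ ↦ t - c)) ⁻¹' (univ ×ˢ Ioo a b') =
      (univ : Set X) ×ˢ Ioo (a + c) (b' + c) := by
    ext ⟨x, t⟩
    simp only [mem_preimage, Prod.map_apply, id_eq, mem_prod, mem_univ, true_and, mem_Ioo]
    constructor <;> rintro ⟨h1, h2⟩ <;> constructor <;> linarith
  have h := (hmp.integrableOn_comp_preimage hme (f := F) (s := univ ×ˢ Ioo a b')).2 hF
  rw [hpre] at h
  exact h

section Forcing

variable {n : ℕ} {M : Type*} [TopologicalSpace M] [T2Space M] [SecondCountableTopology M]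
  [ChartedSpace (EuclideanSpace ℝ (Fin n)) M] [IsManifold (𝓡 n) ∞ M] [T3Space M] [MeasurableSpace M]
  [BorelSpace M]
  {g : PseudoRiemannianMetric (𝓡 n) ∞ (EuclideanSpace ℝ (Fin n)) (TangentSpace (𝓡 n) : M → Type _)}
  [g.HasLeviCivita]

/-- **The forced problem for the ground-state transformed operator on a complete weighted manifold with
arbitrary smooth weight** (see the module docstring): for `Q = ¼|∇V|² − ½ΔV + 1`, `G` smooth with compact
support and `G = 0` for `s ≤ 0`, there is `v` smooth on `M × (−∞, b)`, `v = 0` for `s ≤ 0`,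
`∂ₛv = Δ_g v − Qv + G` on `M × (−∞, b)`, `v² ∈ L¹(M × (0, b))`. [cite: Treves1975, §41, Thm. 40.1]
[cite: Grigoryan2009, §11.4] -/
theorem exists_smooth_schrodingerHeat_forcing (hg : g.IsRiemannian) {V : M → ℝ}
    (hV : ContMDiff (𝓡 n) 𝓘(ℝ, ℝ) ∞ V)
    {η : ℕ → M → ℝ} {C₀ : ℝ} (hηs : ∀ k, ContMDiff (𝓡 n) 𝓘(ℝ, ℝ) ∞ (η k))
    (hηc : ∀ k, HasCompactSupport (η k)) (hη01 : ∀ k x, 0 ≤ η k x ∧ η k x ≤ 1)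
    (hηmono : ∀ k x, η k x ≤ η (k + 1) x) (hη1 : ∀ x, ∀ᶠ k in atTop, η k x = 1)
    (hηgrad : ∀ k x, g.gradSq (η k) x ≤ C₀ / ((k : ℝ) + 1) ^ 2)
    {G : ℝ → M → ℝ} (hG : ContMDiff ((𝓡 n).prod 𝓘(ℝ, ℝ)) 𝓘(ℝ, ℝ) ∞ (fun p : M × ℝ ↦ G p.2 p.1))
    (hGc : HasCompactSupport (fun p : M × ℝ ↦ G p.2 p.1)) (hG0 : ∀ s ≤ (0 : ℝ), ∀ x, G s x = 0)
    {b : ℝ} (hb : 0 < b) :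
    ∃ v : M × ℝ → ℝ, ContMDiffOn ((𝓡 n).prod 𝓘(ℝ, ℝ)) 𝓘(ℝ, ℝ) ∞ v (univ ×ˢ Iio b) ∧
      (∀ x, ∀ s ≤ (0 : ℝ), v (x, s) = 0) ∧
      (∀ x, ∀ s < b, deriv (fun r ↦ v (x, r)) s =
        g.laplaceBeltrami (fun y ↦ v (y, s)) x - (g.gradSq V x / 4 - g.dalembertian V x / 2 + 1) * v (x, s)
          + G s x) ∧
      Integrable (fun p : M × ℝ ↦ v p ^ 2) ((g.riemVolume.prod (volume : Measure ℝ)).restrict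
        (univ ×ˢ Ioo 0 b)) := by
  classical
  haveI : LocallyCompactSpace M := ChartedSpace.locallyCompactSpace (EuclideanSpace ℝ (Fin n)) M
  haveI := CarrilloNi2009_shrinkerLSI.isFiniteMeasureOnCompacts_riemVolume hg
  set μ₀ : Measure M := g.riemVolume with hμ₀
  haveI : μ₀.IsOpenPosMeasure := Literature.Geometry.Riemannian.isOpenPosMeasure_riemVolume hg
  haveI : (μ₀.prod (volume : Measure ℝ)).IsOpenPosMeasure := Measure.prod.instIsOpenPosMeasure
  haveI : SigmaFinite μ₀ := Literature.Geometry.Riemannian.sigmaFinite_riemVolume hg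
  have hab : (-2 : ℝ) < b := by linarith
  -- the potential (time independent, smooth)
  set Q : ℝ → M → ℝ := fun _ x ↦ g.gradSq V x / 4 - g.dalembertian V x / 2 + 1 with hQdef
  have hQ : ContMDiff ((𝓡 n).prod 𝓘(ℝ, ℝ)) 𝓘(ℝ, ℝ) ∞ (fun p : M × ℝ ↦ Q p.2 p.1) := by
    have h1 : ContMDiff (𝓡 n) 𝓘(ℝ, ℝ) ∞ (fun x ↦ g.gradSq V x / 4 - g.dalembertian V x / 2 + 1) :=
      (((contMDiff_gradSq g hV).div_const 4).sub ((contMDiff_dalembertian g hV).div_const 2)).add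
        contMDiff_const
    exact h1.comp contMDiff_fst
  -- Lions' very weak solution on `M × (-2, b)` (perfect-square coercivity), extended by zero
  obtain ⟨u, hum, hu2, hu0, huweak⟩ := exists_veryWeak_linearHeat_of_energyIneq hg (Q := Q) hQ hG hGc
    (a := -2) (b := b) (fun K φ hK hφ hφK hφb ↦ energy_le_integral_mul_schrodingerAdjoint hg hV hab hK hφ hφK hφb)
  -- it is a very weak solution on `M × (-∞, b)` (the forcing vanishes for `s ≤ 0`)
  have huweak' : ∀ ζ : M × ℝ → ℝ, ContMDiff ((𝓡 n).prod 𝓘(ℝ, ℝ)) 𝓘(ℝ, ℝ) ∞ ζ → HasCompactSupport ζ →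
      tsupport ζ ⊆ univ ×ˢ Iio b →
      ∫ p, u p * (-(deriv (fun s ↦ ζ (p.1, s)) p.2) - g.laplaceBeltrami (fun x ↦ ζ (x, p.2)) p.1 +
          Q p.2 p.1 * ζ p) ∂μ₀.prod (volume : Measure ℝ) =
        ∫ p, G p.2 p.1 * ζ p ∂μ₀.prod (volume : Measure ℝ) := by
    intro ζ hζ hζc hζb
    rw [huweak ζ hζ hζc hζb]
    refine setIntegral_eq_integral_of_forall_compl_eq_zero fun p hp ↦ ?_
    by_cases hpb : p.2 < b
    · have hpa : p.2 ≤ -2 := by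
        by_contra h'
        exact hp ⟨mem_univ _, not_le.1 h', hpb⟩
      rw [hG0 p.2 (by linarith) p.1, zero_mul]
    · have hp' : p ∉ tsupport ζ := fun h' ↦ hpb (hζb h').2
      rw [image_eq_zero_of_notMem_tsupport hp', mul_zero]
  -- interior regularity on the open time set `(-∞, b)`
  have hu1 : LocallyIntegrableOn u (univ ×ˢ Iio b) (μ₀.prod (volume : Measure ℝ)) :=
    (hu2.locallyIntegrable (by norm_num)).locallyIntegrableOn _
  obtain ⟨v, hv, hae⟩ := helper_hypoelliptic_noncompact n M g hg Q G hQ hG (Iio b) u isOpen_Iio hum hu1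
    huweak'
  -- the weak identity for the smooth representative
  have hvweak : ∀ ζ : M × ℝ → ℝ, ContMDiff ((𝓡 n).prod 𝓘(ℝ, ℝ)) 𝓘(ℝ, ℝ) ∞ ζ → HasCompactSupport ζ →
      tsupport ζ ⊆ univ ×ˢ Iio b →
      ∫ p, v p * (-(deriv (fun s ↦ ζ (p.1, s)) p.2) - g.laplaceBeltrami (fun x ↦ ζ (x, p.2)) p.1 +
          Q p.2 p.1 * ζ p) ∂μ₀.prod (volume : Measure ℝ) =
        ∫ p, G p.2 p.1 * ζ p ∂μ₀.prod (volume : Measure ℝ) := by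
    intro ζ hζ hζc hζb
    rw [← huweak' ζ hζ hζc hζb]
    refine integral_congr_ae ?_
    filter_upwards [hae] with p hp
    by_cases hpz : p ∈ tsupport ζ
    · rw [hp (hζb hpz)]
    · simp only [staticHeatAdjoint_eq_zero_of_notMem_tsupport Q hpz, mul_zero]
  -- the classical equation on `M × (-∞, b)`
  have hclass : ∀ x, ∀ s < b, deriv (fun r ↦ v (x, r)) s =
      g.laplaceBeltrami (fun y ↦ v (y, s)) x - Q s x * v (x, s) + G s x := by
    intro x s hs
    have h := helper_classicalOfVeryWeak_noncompact n M g hg Q G hQ hG (Iio b) v isOpen_Iio hv hvweak (x, s)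
      ⟨mem_univ _, hs⟩
    simp only at h
    linarith
  -- `v = 0` on `M × (-∞, -2)`, where `u = 0`
  have hv0 : ∀ x, ∀ s < (-2 : ℝ), v (x, s) = 0 := by
    have hO : IsOpen ((univ : Set M) ×ˢ Iio (-2 : ℝ)) := isOpen_univ.prod isOpen_Iio
    have hsub : (univ : Set M) ×ˢ Iio (-2 : ℝ) ⊆ univ ×ˢ Iio b :=
      Set.prod_mono le_rfl (Iio_subset_Iio hab.le)
    have heq : EqOn v 0 ((univ : Set M) ×ˢ Iio (-2 : ℝ)) := by
      refine Measure.eqOn_open_of_ae_eq (μ := μ₀.prod (volume : Measure ℝ)) ?_ hO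
        (hv.mono hsub).continuousOn continuousOn_const
      rw [Filter.EventuallyEq, ae_restrict_iff' hO.measurableSet]
      filter_upwards [hae] with p hp hpO
      rw [← hp (hsub hpO), Pi.zero_apply]
      exact hu0 p fun h' ↦ lt_irrefl _ (h'.1.trans hpO.2)
    intro x s hs
    exact heq ⟨mem_univ _, hs⟩
  -- `v² ∈ L¹` of every strip inside `(-∞, b)` (`v = u` a.e., `u ∈ L²`)
  have hu2sq : Integrable (fun p : M × ℝ ↦ u p ^ 2) (μ₀.prod (volume : Measure ℝ)) := by
    have := hu2.integrable_norm_rpow two_ne_zero ENNReal.ofNat_ne_top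
    refine this.congr (Eventually.of_forall fun p ↦ ?_)
    simp [Real.norm_eq_abs, sq_abs]
  have hv2 : ∀ a' b' : ℝ, b' ≤ b → Integrable (fun p : M × ℝ ↦ v p ^ 2)
      ((μ₀.prod (volume : Measure ℝ)).restrict (univ ×ˢ Ioo a' b')) := by
    intro a' b' hb'
    refine (hu2sq.restrict (s := univ ×ˢ Ioo a' b')).congr ?_
    rw [Filter.EventuallyEq, ae_restrict_iff' (MeasurableSet.univ.prod measurableSet_Ioo)]
    filter_upwards [hae] with p hp hpS
    rw [hp ⟨mem_univ _, lt_of_lt_of_le hpS.2.2 hb'⟩]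
  /- `v = 0` on `M × [-3, 0]`: the weighted `L²` maximum principle for `z(r, x) = e^{V/2} e^{r} v(x, r − 3)`,
    which solves `∂ᵣz = Lz` on `[0, 3]` with `z(0) = 0` -/
  have hv00 : ∀ s ∈ Icc (-3 : ℝ) 0, ∀ x, v (x, s) = 0 := by
    -- the shifted open time set and the candidates `± z`
    set O : Set ℝ := Iio (b + 3) with hOdef
    have hO : IsOpen O := isOpen_Iio
    have hTO : Icc (0 : ℝ) 3 ⊆ O := fun r hr ↦ by simp only [hOdef, mem_Iio]; linarith [hr.2]
    have hshift : ContMDiff ((𝓡 n).prod 𝓘(ℝ, ℝ)) ((𝓡 n).prod 𝓘(ℝ, ℝ)) ∞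
        (fun p : M × ℝ ↦ ((p.1, p.2 - 3) : M × ℝ)) := contMDiff_fst.prodMk (contMDiff_snd.sub contMDiff_const)
    have hvs : ContMDiffOn ((𝓡 n).prod 𝓘(ℝ, ℝ)) 𝓘(ℝ, ℝ) ∞ (fun p : M × ℝ ↦ v (p.1, p.2 - 3)) (univ ×ˢ O) :=
      hv.comp hshift.contMDiffOn fun p hp ↦ ⟨mem_univ _, by
        have := hp.2; simp only [hOdef, mem_Iio] at this ⊢; linarith⟩
    have hE : ContMDiff ((𝓡 n).prod 𝓘(ℝ, ℝ)) 𝓘(ℝ, ℝ) ∞ (fun p : M × ℝ ↦ Real.exp (V p.1 / 2)) :=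
      ((contMDiff_iff_contDiff.2 Real.contDiff_exp).comp ((hV.comp contMDiff_fst).div_const 2))
    have hL : ContMDiff ((𝓡 n).prod 𝓘(ℝ, ℝ)) 𝓘(ℝ, ℝ) ∞ (fun p : M × ℝ ↦ Real.exp p.2) :=
      (contMDiff_iff_contDiff.2 Real.contDiff_exp).comp contMDiff_snd
    set z : ℝ → M → ℝ := fun r x ↦ Real.exp (V x / 2) * (Real.exp r * v (x, r - 3)) with hzdef
    have hzs : ContMDiffOn ((𝓡 n).prod 𝓘(ℝ, ℝ)) 𝓘(ℝ, ℝ) ∞ (fun p : M × ℝ ↦ z p.2 p.1) (univ ×ˢ O) :=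
      hE.contMDiffOn.mul (hL.contMDiffOn.mul hvs)
    have hnzs : ContMDiffOn ((𝓡 n).prod 𝓘(ℝ, ℝ)) 𝓘(ℝ, ℝ) ∞ (fun p : M × ℝ ↦ -z p.2 p.1) (univ ×ˢ O) := hzs.neg
    -- the equation for `z` on `[0, 3]`
    have hzeq : ∀ r ∈ Icc (0 : ℝ) 3, ∀ x, deriv (fun r' ↦ z r' x) r = g.dalembertian (z r) x
        - g.innerDual x (mvfderiv (𝓡 n) V x).toLinearMap (mvfderiv (𝓡 n) (z r) x).toLinearMap := by
      intro r hr x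
      have hsr : r - 3 < b := by linarith [hr.2]
      have h2le : (2 : ℕ∞ω) ≤ (∞ : ℕ∞ω) := by norm_cast
      -- the slice `y ↦ v(y, r - 3)` is smooth
      have hvsl : ContMDiff (𝓡 n) 𝓘(ℝ, ℝ) ∞ (fun y ↦ v (y, r - 3)) :=
        hv.comp_contMDiff (f := fun y : M ↦ ((y, r - 3) : M × ℝ)) (contMDiff_id.prodMk contMDiff_const)
          fun y ↦ ⟨mem_univ _, hsr⟩
      have hvs2 : ContMDiffAt (𝓡 n) 𝓘(ℝ, ℝ) 2 (fun y ↦ v (y, r - 3)) x := (hvsl.of_le h2le).contMDiffAt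
      -- the equation of `v` at time `r - 3 ≤ 0` (no forcing)
      have hdv : HasDerivAt (fun r' ↦ v (x, r' - 3))
          (g.dalembertian (fun y ↦ v (y, r - 3)) x - Q (r - 3) x * v (x, r - 3)) r := by
        have h1 : HasDerivAt (fun s ↦ v (x, s)) (deriv (fun s ↦ v (x, s)) (r - 3)) (r - 3) :=
          hasDerivAt_slice_of_contMDiffOn isOpen_Iio hv x hsr
        have h2 : HasDerivAt (fun r' : ℝ ↦ r' - 3) 1 r := by simpa using (hasDerivAt_id r).sub_const 3
        have h3 := h1.comp r h2
        rw [hclass x (r - 3) hsr, hG0 (r - 3) (by linarith [hr.2]) x, add_zero,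
          laplaceBeltrami_eq_dalembertian, mul_one] at h3
        exact h3
      -- the shifted function `w̃ = e^{r} v`
      set wt : ℝ → M → ℝ := fun r' y ↦ Real.exp r' * v (y, r' - 3) with hwtdef
      have hwt2 : ContMDiffAt (𝓡 n) 𝓘(ℝ, ℝ) 2 (wt r) x := (contMDiffAt_const.mul hvs2 :)
      have hdwt : HasDerivAt (fun r' ↦ wt r' x)
          (g.dalembertian (wt r) x - (g.gradSq V x / 4 - g.dalembertian V x / 2) * wt r x) r := by
        have h := (Real.hasDerivAt_exp r).mul hdv
        have hΔ : g.dalembertian (wt r) x = Real.exp r * g.dalembertian (fun y ↦ v (y, r - 3)) x := by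
          show g.dalembertian (fun y ↦ Real.exp r * v (y, r - 3)) x = _
          exact g.dalembertian_const_mul_of_contMDiffAt hvs2 _
        rw [hΔ]
        refine h.congr_deriv ?_
        simp only [hwtdef, hQdef]
        ring
      have hconj := heatDrift_of_potential g hV (S := univ) hwt2 hdwt.hasDerivWithinAt
      have hdz : HasDerivAt (fun r' ↦ z r' x)
          (g.dalembertian (z r) x - g.innerDual x (mvfderiv (𝓡 n) V x).toLinearMap
            (mvfderiv (𝓡 n) (z r) x).toLinearMap) r := by
        have h := hconj.hasDerivAt (Filter.univ_mem)
        simpa [hzdef, hwtdef] using h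
      exact hdz.deriv
    have hnzeq : ∀ r ∈ Icc (0 : ℝ) 3, ∀ x, deriv (fun r' ↦ -z r' x) r = g.dalembertian (fun y ↦ -z r y) x
        - g.innerDual x (mvfderiv (𝓡 n) V x).toLinearMap (mvfderiv (𝓡 n) (fun y ↦ -z r y) x).toLinearMap := by
      intro r hr x
      have hsr : r - 3 < b := by linarith [hr.2]
      have h2le : (2 : ℕ∞ω) ≤ (∞ : ℕ∞ω) := by norm_cast
      have hzsl : ContMDiff (𝓡 n) 𝓘(ℝ, ℝ) ∞ (z r) :=
        hzs.comp_contMDiff (f := fun y : M ↦ ((y, r) : M × ℝ)) (contMDiff_id.prodMk contMDiff_const)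
          fun y ↦ ⟨mem_univ _, hTO hr⟩
      have hz2 : ContMDiffAt (𝓡 n) 𝓘(ℝ, ℝ) 2 (z r) x := (hzsl.of_le h2le).contMDiffAt
      have haff := weightedLaplacian_affine (g := g) (V := V) hz2 (-1) 0
      have hdn : deriv (fun r' ↦ -z r' x) r = -deriv (fun r' ↦ z r' x) r :=
        (CutoffToolkit.hasDerivAt_time hO hzs x (hTO hr)).neg.deriv
      rw [hdn, hzeq r hr x]
      have e1 : (fun y ↦ -z r y) = fun y ↦ (-1) * z r y + 0 := funext fun y ↦ by ring
      rw [e1, haff]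
      ring
    -- the initial values vanish: `v(x, -3) = 0`
    have hz0 : ∀ x, z 0 x ≤ 0 := fun x ↦ by
      simp only [hzdef, hv0 x (0 - 3) (by norm_num), mul_zero, le_refl]
    have hnz0 : ∀ x, -z 0 x ≤ 0 := fun x ↦ by
      simp only [hzdef, hv0 x (0 - 3) (by norm_num), mul_zero, neg_zero, le_refl]
    -- integrability of `z₊² e^{-V}` and `(-z)₊² e^{-V}` on the strip `(0, 3)`: both are `≤ e^{6} v(x, r-3)²`
    have hvshift : Integrable (fun p : M × ℝ ↦ v (p.1, p.2 - 3) ^ 2)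
        ((μ₀.prod (volume : Measure ℝ)).restrict (univ ×ˢ Ioo 0 3)) := by
      have h := integrable_strip_comp_sub μ₀ (F := fun p : M × ℝ ↦ v p ^ 2) 3 (hv2 (-3) 0 hb.le)
      norm_num at h
      exact h
    have hmeasS : MeasurableSet ((univ : Set M) ×ˢ Ioo (0 : ℝ) 3) := MeasurableSet.univ.prod measurableSet_Ioo
    have hdom : ∀ {ζ : ℝ → M → ℝ}, (∀ r x, ζ r x = z r x ∨ ζ r x = -z r x) →
        ContMDiffOn ((𝓡 n).prod 𝓘(ℝ, ℝ)) 𝓘(ℝ, ℝ) ∞ (fun p : M × ℝ ↦ ζ p.2 p.1) (univ ×ˢ O) →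
        Integrable (fun p : M × ℝ ↦ max (ζ p.2 p.1) 0 ^ 2 * Real.exp (-V p.1))
          ((μ₀.prod (volume : Measure ℝ)).restrict (univ ×ˢ Ioo 0 3)) := by
      intro ζ hζ hζs
      refine (hvshift.const_mul (Real.exp 6)).mono' ?_ ?_
      · have h1 : ContinuousOn (fun p : M × ℝ ↦ ζ p.2 p.1) ((univ : Set M) ×ˢ Ioo (0 : ℝ) 3) :=
          hζs.continuousOn.mono (Set.prod_mono le_rfl fun r hr ↦ hTO (Ioo_subset_Icc_self hr))
        have h2 : ContinuousOn (fun p : M × ℝ ↦ max (ζ p.2 p.1) 0) ((univ : Set M) ×ˢ Ioo (0 : ℝ) 3) :=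
          (continuous_id.max continuous_const).comp_continuousOn h1
        have hc : ContinuousOn (fun p : M × ℝ ↦ max (ζ p.2 p.1) 0 ^ 2 * Real.exp (-V p.1))
            ((univ : Set M) ×ˢ Ioo (0 : ℝ) 3) :=
          (h2.pow 2).mul (Real.continuous_exp.comp (hV.continuous.comp continuous_fst).neg).continuousOn
        exact hc.aestronglyMeasurable hmeasS
      · rw [ae_restrict_iff' hmeasS]
        refine Eventually.of_forall fun p hp ↦ ?_
        obtain ⟨-, hr⟩ := hp
        have hsq : max (ζ p.2 p.1) 0 ^ 2 ≤ z p.2 p.1 ^ 2 := by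
          rcases hζ p.2 p.1 with h | h <;> rw [h]
          · rcases le_or_gt (z p.2 p.1) 0 with h' | h'
            · rw [max_eq_right h', zero_pow two_ne_zero]; exact sq_nonneg _
            · rw [max_eq_left h'.le]
          · rcases le_or_gt (-z p.2 p.1) 0 with h' | h'
            · rw [max_eq_right h', zero_pow two_ne_zero]; exact sq_nonneg _
            · rw [max_eq_left h'.le, neg_sq]
        have hE2 : Real.exp (V p.1 / 2) ^ 2 * Real.exp (-V p.1) = 1 := by
          rw [sq, ← Real.exp_add, ← Real.exp_add]
          convert Real.exp_zero using 2
          ring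
        have hz2 : z p.2 p.1 ^ 2 * Real.exp (-V p.1) = Real.exp p.2 ^ 2 * v (p.1, p.2 - 3) ^ 2 := by
          simp only [hzdef]
          calc (Real.exp (V p.1 / 2) * (Real.exp p.2 * v (p.1, p.2 - 3))) ^ 2 * Real.exp (-V p.1)
              = (Real.exp (V p.1 / 2) ^ 2 * Real.exp (-V p.1)) * (Real.exp p.2 ^ 2 * v (p.1, p.2 - 3) ^ 2) := by
                ring
            _ = _ := by rw [hE2, one_mul]
        have hexp : Real.exp p.2 ^ 2 ≤ Real.exp 6 := by
          rw [sq, ← Real.exp_add]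
          exact Real.exp_le_exp.2 (by linarith [hr.2])
        rw [Real.norm_eq_abs, abs_of_nonneg (mul_nonneg (sq_nonneg _) (Real.exp_pos _).le)]
        calc max (ζ p.2 p.1) 0 ^ 2 * Real.exp (-V p.1) ≤ z p.2 p.1 ^ 2 * Real.exp (-V p.1) :=
              mul_le_mul_of_nonneg_right hsq (Real.exp_pos _).le
          _ = Real.exp p.2 ^ 2 * v (p.1, p.2 - 3) ^ 2 := hz2
          _ ≤ Real.exp 6 * v (p.1, p.2 - 3) ^ 2 := mul_le_mul_of_nonneg_right hexp (sq_nonneg _)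
    have hintz := hdom (ζ := z) (fun r x ↦ Or.inl rfl) hzs
    have hintnz := hdom (ζ := fun r x ↦ -z r x) (fun r x ↦ Or.inr rfl) hnzs
    -- the maximum principle, twice
    have hle := gaffney_maxPrinciple hg hV hηs hηc hη01 hηmono hη1 hηgrad (T := 3) hO hTO hzs hzeq hz0 hintz
    have hge := gaffney_maxPrinciple hg hV hηs hηc hη01 hηmono hη1 hηgrad (T := 3) hO hTO hnzs hnzeq hnz0 hintnz
    intro s hs x
    have hr : s + 3 ∈ Icc (0 : ℝ) 3 := ⟨by linarith [hs.1], by linarith [hs.2]⟩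
    have hz : z (s + 3) x = 0 := le_antisymm (hle (s + 3) hr x) (by linarith [hge (s + 3) hr x])
    have hne : Real.exp (V x / 2) * Real.exp (s + 3) ≠ 0 := (mul_pos (Real.exp_pos _) (Real.exp_pos _)).ne'
    have h3 : s + 3 - 3 = s := by ring
    simp only [hzdef, h3] at hz
    have : Real.exp (V x / 2) * Real.exp (s + 3) * v (x, s) = 0 := by rw [mul_assoc]; exact hz
    rcases mul_eq_zero.1 this with h | h
    · exact absurd h hne
    · exact h
  refine ⟨v, hv, fun x s hs ↦ ?_, fun x s hs ↦ by rw [hclass x s hs], hv2 0 b le_rfl⟩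
  rcases lt_or_ge s (-2) with hs' | hs'
  · exact hv0 x s hs'
  · exact hv00 s ⟨by linarith, hs⟩ x

end Forcing

end Literature.Geometry.Riemannian.BakryEmeryComplete

end Part5

/-!
## Part 6 — port of `Summits/SmoothPoincare4/SmoothPoincare4/Theorems/EntropyRungBakryEmeryLogSobolevCauchy.lean` (1 declarations kept)

# The linear Cauchy problem for the ground-state transformed heat operator with compactly supported
# datum on a complete weighted manifold with ARBITRARY smooth weight

`linearHeat_cauchy_gaffney`: the shrinker toolkit's `helper_linearHeat_noncompact`
(`Summits/…/EntropyRungNoncompactShrinkerGapHeatLinearHeat.lean`; Trèves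
1975, §41) for the potential `Q = ¼|∇V|² − ½Δ_gV + 1` of an ARBITRARY smooth weight `e^{-V}` (no lower
bound) and first-order (Gaffney) cut-offs: given flat-corrector data `(W, G, K)` (`W`, `G` smooth on
`M × ℝ`, vanishing off the compact `K` and for `s ≥ 1`, `G = 0` for `s ≤ 0`, `G = −(∂ₛW − ΔW + QW)` for
`s ≥ 0`, as produced by `helper_flatCorrector_noncompact`), for every `T > 0` there is `w` smooth on
`M × (−∞, T + 1)` with `w(0) = W(0)`, `∂ₛw = Δ_g w − Qw` on `[0, T]`, and `w ∈ L²(M × (0, T))`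
(`w = W + v` with the forced solution `v` of `exists_smooth_schrodingerHeat_forcing`). The proof is the
toolkit's, with that one call replaced. Everything is proved; no definitions, no named facts.

## References

* [Treves1975] F. Trèves, *Basic Linear Partial Differential Equations* (1975), §41, Thm. 40.1.
* [Grigoryan2009] A. Grigor'yan (2009), Ch. 8.
-/

section Part6

open scoped _root_.Manifold _root_.ContDiff _root_.ENNReal _root_.NNReal _root_.Topology
open _root_.MeasureTheory _root_.Set _root_.Filter
open Literature.Geometry.Lorentzian Literature.Geometry.Riemannian
open Literature.Geometry.Lorentzian.PseudoRiemannianMetric (laplaceBeltrami_eq_dalembertian)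

namespace Literature.Geometry.Riemannian.BakryEmeryComplete

open NoncompactShrinkerGapHeat

section Cauchy

variable {n : ℕ} {M : Type*} [TopologicalSpace M] [T2Space M] [SecondCountableTopology M]
  [ChartedSpace (EuclideanSpace ℝ (Fin n)) M] [IsManifold (𝓡 n) ∞ M] [T3Space M] [MeasurableSpace M]
  [BorelSpace M]
  {g : PseudoRiemannianMetric (𝓡 n) ∞ (EuclideanSpace ℝ (Fin n)) (TangentSpace (𝓡 n) : M → Type _)}
  [g.HasLeviCivita]

/-- **The linear Cauchy problem `∂ₛw = Δ_g w − Qw`, `w(0) = W(0)`, `Q = ¼|∇V|² − ½ΔV + 1`, for flat-corrector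
data on a complete weighted manifold with arbitrary smooth weight and Gaffney cut-offs** (see the module
docstring). [cite: Treves1975, §41, Thm. 40.1] -/
theorem linearHeat_cauchy_gaffney (hg : g.IsRiemannian) {V : M → ℝ} (hV : ContMDiff (𝓡 n) 𝓘(ℝ, ℝ) ∞ V)
    {η : ℕ → M → ℝ} {C₀ : ℝ} (hηs : ∀ k, ContMDiff (𝓡 n) 𝓘(ℝ, ℝ) ∞ (η k))
    (hηc : ∀ k, HasCompactSupport (η k)) (hη01 : ∀ k x, 0 ≤ η k x ∧ η k x ≤ 1)
    (hηmono : ∀ k x, η k x ≤ η (k + 1) x) (hη1 : ∀ x, ∀ᶠ k in atTop, η k x = 1)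
    (hηgrad : ∀ k x, g.gradSq (η k) x ≤ C₀ / ((k : ℝ) + 1) ^ 2)
    {W G : ℝ → M → ℝ} {K : Set M} (hK : IsCompact K)
    (hW : ContMDiff ((𝓡 n).prod 𝓘(ℝ, ℝ)) 𝓘(ℝ, ℝ) ∞ (fun p : M × ℝ ↦ W p.2 p.1))
    (hG : ContMDiff ((𝓡 n).prod 𝓘(ℝ, ℝ)) 𝓘(ℝ, ℝ) ∞ (fun p : M × ℝ ↦ G p.2 p.1))
    (hWK : ∀ s x, x ∉ K → W s x = 0) (hGK : ∀ s x, x ∉ K → G s x = 0)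
    (hWG1 : ∀ s, 1 ≤ s → ∀ x, W s x = 0 ∧ G s x = 0) (hG0 : ∀ s ≤ 0, ∀ x, G s x = 0)
    (hGW : ∀ s, 0 ≤ s → ∀ x, G s x = -(deriv (fun r ↦ W r x) s
      - (g.laplaceBeltrami (W s) x - (g.gradSq V x / 4 - g.dalembertian V x / 2 + 1) * W s x)))
    {T : ℝ} (hT : 0 < T) :
    ∃ (O : Set ℝ) (w : ℝ → M → ℝ), IsOpen O ∧ Icc 0 T ⊆ O ∧
      ContMDiffOn ((𝓡 n).prod 𝓘(ℝ, ℝ)) 𝓘(ℝ, ℝ) ∞ (fun p : M × ℝ ↦ w p.2 p.1) (univ ×ˢ O) ∧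
      (∀ x, w 0 x = W 0 x) ∧
      (∀ s ∈ Icc 0 T, ∀ x, deriv (fun r ↦ w r x) s =
        g.dalembertian (w s) x - (g.gradSq V x / 4 - g.dalembertian V x / 2 + 1) * w s x) ∧
      Integrable (fun p : M × ℝ ↦ w p.2 p.1 ^ 2)
        ((g.riemVolume.prod (volume : Measure ℝ)).restrict (univ ×ˢ Ioo 0 T)) := by
  classical
  haveI : LocallyCompactSpace M := ChartedSpace.locallyCompactSpace (EuclideanSpace ℝ (Fin n)) M
  haveI := CarrilloNi2009_shrinkerLSI.isFiniteMeasureOnCompacts_riemVolume hg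
  haveI : SigmaFinite g.riemVolume := Literature.Geometry.Riemannian.sigmaFinite_riemVolume hg
  -- `G` has compact support in `K × [0, 1]`
  have hGc : HasCompactSupport (fun p : M × ℝ ↦ G p.2 p.1) := by
    refine HasCompactSupport.intro (hK.prod (isCompact_Icc (a := (0 : ℝ)) (b := 1))) ?_
    rintro ⟨x, s⟩ hp
    simp only [mem_prod, mem_Icc, not_and_or, not_le] at hp
    rcases hp with hx | hs | hs
    · exact hGK s x hx
    · exact hG0 s hs.le x
    · exact (hWG1 s hs.le x).2
  set b : ℝ := T + 1 with hbdef
  have hb : 0 < b := by rw [hbdef]; linarith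
  obtain ⟨v, hv, hv0, hveq, hvL2⟩ := exists_smooth_schrodingerHeat_forcing hg hV hηs hηc hη01 hηmono hη1
    hηgrad hG hGc hG0 hb
  -- the solution `w = W + v`
  set w : ℝ → M → ℝ := fun s x ↦ W s x + v (x, s) with hwdef
  have hws : ContMDiffOn ((𝓡 n).prod 𝓘(ℝ, ℝ)) 𝓘(ℝ, ℝ) ∞ (fun p : M × ℝ ↦ w p.2 p.1) (univ ×ˢ Iio b) :=
    hW.contMDiffOn.add hv
  refine ⟨Iio b, w, isOpen_Iio, fun s hs ↦ by simp only [mem_Iio, hbdef]; linarith [hs.2], hws, fun x ↦ ?_,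
    fun s hs x ↦ ?_, ?_⟩
  · simp [hwdef, hv0 x 0 le_rfl]
  · -- the equation on `[0, T]`
    have hsb : s < b := by rw [hbdef]; linarith [hs.2]
    have hdW : HasDerivAt (fun r ↦ W r x) (deriv (fun r ↦ W r x) s) s :=
      ((contDiff_time_slice hW x).differentiable (by simp)).differentiableAt.hasDerivAt
    have hdv : HasDerivAt (fun r ↦ v (x, r)) (deriv (fun r ↦ v (x, r)) s) s :=
      hasDerivAt_slice_of_contMDiffOn isOpen_Iio hv x hsb
    have hd : deriv (fun r ↦ w r x) s = deriv (fun r ↦ W r x) s + deriv (fun r ↦ v (x, r)) s :=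
      (hdW.add hdv).deriv
    have h2 : (2 : ℕ∞ω) ≤ (∞ : ℕ∞ω) := by norm_cast
    have hWs2 : ContMDiffAt (𝓡 n) 𝓘(ℝ, ℝ) 2 (W s) x :=
      ((contMDiff_space_slice hW s).of_le h2).contMDiffAt
    have hvs2 : ContMDiffAt (𝓡 n) 𝓘(ℝ, ℝ) 2 (fun y ↦ v (y, s)) x := by
      have hO : IsOpen ((univ : Set M) ×ˢ Iio b) := isOpen_univ.prod isOpen_Iio
      have h1 : ContMDiffOn (𝓡 n) 𝓘(ℝ, ℝ) ∞ (fun y ↦ v (y, s)) univ := fun y _ ↦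
        (hv.comp_contMDiff (f := fun y : M ↦ ((y, s) : M × ℝ)) (contMDiff_id.prodMk contMDiff_const)
          (fun y ↦ ⟨mem_univ _, hsb⟩)).contMDiffAt.contMDiffWithinAt
      exact ((contMDiffOn_univ.1 h1).of_le h2).contMDiffAt
    have hΔ : g.dalembertian (w s) x = g.dalembertian (W s) x + g.dalembertian (fun y ↦ v (y, s)) x := by
      have := g.dalembertian_add_of_contMDiffAt hWs2 hvs2
      simpa [hwdef, Pi.add_def] using this
    have hGW' := hGW s hs.1 x
    have hveq' := hveq x s hsb
    rw [laplaceBeltrami_eq_dalembertian] at hGW' hveq'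
    simp only [hwdef]
    rw [hd, hΔ]
    linarith
  · -- `w² ∈ L¹(M × (0, T))`: `W` is bounded with compact spatial support, `v ∈ L²`
    have hmeasS : MeasurableSet ((univ : Set M) ×ˢ Ioo (0 : ℝ) T) := MeasurableSet.univ.prod measurableSet_Ioo
    have hvT : Integrable (fun p : M × ℝ ↦ v p ^ 2)
        ((g.riemVolume.prod (volume : Measure ℝ)).restrict (univ ×ˢ Ioo 0 T)) := by
      refine hvL2.mono_measure (Measure.restrict_mono (Set.prod_mono le_rfl (Ioo_subset_Ioo le_rfl ?_)) le_rfl)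
      rw [hbdef]; linarith
    obtain ⟨B, hB⟩ := (hK.prod (isCompact_Icc (a := (0 : ℝ)) (b := T))).exists_bound_of_continuousOn
      (f := fun p : M × ℝ ↦ W p.2 p.1) hW.continuous.continuousOn
    have hWbd : ∀ p ∈ (univ : Set M) ×ˢ Ioo (0 : ℝ) T,
        ‖W p.2 p.1‖ ≤ (K ×ˢ (univ : Set ℝ)).indicator (fun _ ↦ max B 0) p := by
      rintro ⟨x, s⟩ ⟨-, hs⟩
      by_cases hx : x ∈ K
      · rw [indicator_of_mem (show ((x, s) : M × ℝ) ∈ K ×ˢ (univ : Set ℝ) from ⟨hx, mem_univ _⟩)]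
        exact (hB (x, s) ⟨hx, Ioo_subset_Icc_self hs⟩).trans (le_max_left _ _)
      · rw [indicator_of_notMem (show ((x, s) : M × ℝ) ∉ K ×ˢ (univ : Set ℝ) from fun h ↦ hx h.1)]
        simp [hWK s x hx]
    set ν : Measure (M × ℝ) := (g.riemVolume.prod (volume : Measure ℝ)).restrict (univ ×ˢ Ioo 0 T) with hν
    have hKfin : ν (K ×ˢ (univ : Set ℝ)) ≠ (⊤ : ℝ≥0∞) := by
      rw [hν, Measure.restrict_apply (hK.measurableSet.prod MeasurableSet.univ)]
      have h1 : K ×ˢ (univ : Set ℝ) ∩ (univ : Set M) ×ˢ Ioo (0 : ℝ) T = K ×ˢ Ioo (0 : ℝ) T := by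
        ext ⟨x, s⟩; simp [mem_prod]
      rw [h1, Measure.prod_prod]
      exact (ENNReal.mul_lt_top (hK.measure_lt_top) measure_Ioo_lt_top).ne
    have hdom : Integrable (fun p : M × ℝ ↦ ((K ×ˢ (univ : Set ℝ)).indicator (fun _ ↦ max B 0) p) ^ 2 +
        v p ^ 2 + 2 * (((K ×ˢ (univ : Set ℝ)).indicator (fun _ ↦ max B 0) p) * |v p|)) ν := by
      have hI : Integrable (fun p : M × ℝ ↦ (K ×ˢ (univ : Set ℝ)).indicator (fun _ ↦ max B 0) p) ν :=
        (integrableOn_const (C := max B 0) hKfin).integrable_indicator (hK.measurableSet.prod MeasurableSet.univ)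
      have hI2 : Integrable (fun p : M × ℝ ↦ ((K ×ˢ (univ : Set ℝ)).indicator (fun _ ↦ max B 0) p) ^ 2) ν := by
        have : (fun p : M × ℝ ↦ ((K ×ˢ (univ : Set ℝ)).indicator (fun _ ↦ max B 0) p) ^ 2) =
            (K ×ˢ (univ : Set ℝ)).indicator (fun _ ↦ (max B 0) ^ 2) := by
          funext p
          by_cases hp : p ∈ K ×ˢ (univ : Set ℝ)
          · simp [indicator_of_mem hp]
          · simp [indicator_of_notMem hp]
        rw [this]
        exact (integrableOn_const (C := (max B 0) ^ 2) hKfin).integrable_indicator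
          (hK.measurableSet.prod MeasurableSet.univ)
      -- `indicator * |v|` is dominated by `indicator² + v²` up to the factor 1/2; use `2ab ≤ a² + b²`
      have hIv : Integrable (fun p : M × ℝ ↦ ((K ×ˢ (univ : Set ℝ)).indicator (fun _ ↦ max B 0) p) * |v p|) ν := by
        refine (hI2.add hvT).mono' ?_ (Eventually.of_forall fun p ↦ ?_)
        · refine (hI.aestronglyMeasurable.mul ?_)
          have hvc : ContinuousOn v ((univ : Set M) ×ˢ Ioo (0 : ℝ) T) :=
            hv.continuousOn.mono (Set.prod_mono le_rfl fun s hs ↦ by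
              simp only [mem_Iio, hbdef]; linarith [hs.2])
          exact (hvc.aestronglyMeasurable hmeasS).norm.congr (Eventually.of_forall fun p ↦ by
            simp [Real.norm_eq_abs])
        · show ‖(K ×ˢ (univ : Set ℝ)).indicator (fun _ ↦ max B 0) p * |v p|‖ ≤
            ((K ×ˢ (univ : Set ℝ)).indicator (fun _ ↦ max B 0) p) ^ 2 + v p ^ 2
          rw [Real.norm_eq_abs, abs_mul, abs_abs]
          have ha : 0 ≤ (K ×ˢ (univ : Set ℝ)).indicator (fun _ ↦ max B 0) p := by
            by_cases hp : p ∈ K ×ˢ (univ : Set ℝ)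
            · simp [indicator_of_mem hp]
            · simp [indicator_of_notMem hp]
          rw [abs_of_nonneg ha]
          nlinarith [sq_nonneg ((K ×ˢ (univ : Set ℝ)).indicator (fun _ ↦ max B 0) p - |v p|), sq_abs (v p)]
      exact (hI2.add hvT).add (hIv.const_mul 2)
    refine hdom.mono' ?_ ?_
    · have hwc : ContinuousOn (fun p : M × ℝ ↦ w p.2 p.1 ^ 2) ((univ : Set M) ×ˢ Ioo (0 : ℝ) T) :=
        (hws.continuousOn.mono (Set.prod_mono le_rfl fun s hs ↦ by
          simp only [mem_Iio, hbdef]; linarith [hs.2])).pow 2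
      exact hwc.aestronglyMeasurable hmeasS
    · rw [hν, ae_restrict_iff' hmeasS]
      refine Eventually.of_forall fun p hp ↦ ?_
      have h1 := hWbd p hp
      rw [Real.norm_eq_abs] at h1
      rw [Real.norm_eq_abs, abs_pow, hwdef]
      simp only
      have h2 : |W p.2 p.1 + v (p.1, p.2)| ≤ |W p.2 p.1| + |v p| := by
        simpa using abs_add_le (W p.2 p.1) (v (p.1, p.2))
      have h3 : 0 ≤ |W p.2 p.1| := abs_nonneg _
      have h4 : 0 ≤ |v p| := abs_nonneg _
      calc |W p.2 p.1 + v (p.1, p.2)| ^ 2 ≤ (|W p.2 p.1| + |v p|) ^ 2 :=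
            pow_le_pow_left₀ (abs_nonneg _) h2 2
        _ ≤ ((K ×ˢ (univ : Set ℝ)).indicator (fun _ ↦ max B 0) p + |v p|) ^ 2 := by
            apply pow_le_pow_left₀ (by positivity)
            linarith
        _ = ((K ×ˢ (univ : Set ℝ)).indicator (fun _ ↦ max B 0) p) ^ 2 + v p ^ 2 +
              2 * (((K ×ˢ (univ : Set ℝ)).indicator (fun _ ↦ max B 0) p) * |v p|) := by
            rw [add_sq, sq_abs]; ring

end Cauchy

end Literature.Geometry.Riemannian.BakryEmeryComplete

end Part6

/-!
## Part 7 — port of `Summits/SmoothPoincare4/SmoothPoincare4/Theorems/EntropyRungNoncompactShrinkerGapHeatFlatCorrector.lean` (2 declarations kept)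

# The flat corrector for compactly supported data on a non-compact manifold

Registered helper `helper_flatCorrector_noncompact` of the stub `stub_compactSupportLSI`: the non-compact
version of `exists_flat_corrector` (`LinearHeatBorel.lean`, closed manifolds) for COMPACTLY SUPPORTED data.
For a Riemannian metric `g` on a manifold `M` modelled on `ℝⁿ` (Hausdorff, second countable — NOT compact),
a potential `Q` smooth on `M × ℝ` and a smooth compactly supported datum `w₀` there are `W`, `G` smooth on
`M × ℝ` and a compact `K ⊆ M` with `W(0) = w₀`, `W` and `G` vanishing off `K` and for `s ≥ 1`, `G = 0`
for `s ≤ 0`, and `G = −(∂ₛW − Δ_g W + QW)` for `s ≥ 0`.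

Proof: Borel summation of the formal power series solution exactly as in the closed case — the jets
`a_k = heatJet` of the formal solution are supported in `tsupport w₀` (differential operators do not
enlarge supports), so Borel's lemma in time is only needed on the compact `tsupport w₀`: a finite cover
by chart domains inside a relatively compact neighbourhood, a smooth partition of unity on `tsupport w₀`
subordinate to it (compactly supported bumps), the cut-off series `exists_borel_extension` on the model
space chart by chart (`exists_contMDiff_forall_iteratedDeriv_eq_of_isCompact`); the residual is flat
(`iteratedDeriv_residual_eq_zero`) and is glued with zero across `s = 0` (`contMDiff_timeCutoff_manifold`);
a time cut-off `θ(s)` (`θ = 1` near `(−∞, 0]`, `θ = 0` on `[1, ∞)`) makes everything vanish for `s ≥ 1`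
without changing the jets at `s = 0`.

References: L. Hörmander, *ALPDO I*, Thm. 1.2.6 (Borel); F. Trèves, *Basic Linear Partial Differential
Equations* (1975), §41.
-/

section Part7

open _root_.Set _root_.Function _root_.Filter _root_.Manifold _root_.Bundle
open scoped _root_.Manifold _root_.ContDiff _root_.Topology

namespace Literature.Geometry.Riemannian.NoncompactShrinkerGapHeat

open Literature.Geometry.Riemannian Literature.Geometry.Lorentzian
open Literature.Geometry.Lorentzian.PseudoRiemannianMetric Literature.Analysis.Calculus

/-! ### Borel's lemma in time on a compact subset of a manifold -/

section ManifoldBorel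

variable {E : Type*} [NormedAddCommGroup E] [NormedSpace ℝ E] [FiniteDimensional ℝ E]
  {H : Type*} [TopologicalSpace H] {I : ModelWithCorners ℝ E H} [I.Boundaryless]
  {M : Type*} [TopologicalSpace M] [ChartedSpace H M] [IsManifold I ∞ M] [T2Space M]

variable [LocallyCompactSpace M] [SigmaCompactSpace M]

end ManifoldBorel

/-! ### The flat corrector with compact support -/

section Corrector

variable {n : ℕ} {M : Type*} [TopologicalSpace M] [T2Space M] [SecondCountableTopology M]
  [ChartedSpace (EuclideanSpace ℝ (Fin n)) M] [IsManifold (𝓡 n) ∞ M]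

/-- A smooth time cut-off `θ : ℝ → ℝ` with `θ = 1` on `(−∞, 1/2]` and `θ = 0` on `[1, ∞)`. [cite: Treves1975, §41] -/
theorem exists_timeCutoff : ∃ θ : ℝ → ℝ, ContDiff ℝ ∞ θ ∧ (∀ s ≤ (1 / 2 : ℝ), θ s = 1) ∧
    ∀ s, (1 : ℝ) ≤ s → θ s = 0 := by
  refine ⟨fun s ↦ Real.smoothTransition (2 - 2 * s),
    Real.smoothTransition.contDiff.comp (contDiff_const.sub (contDiff_const.mul contDiff_id)),
    fun s hs ↦ Real.smoothTransition.one_of_one_le (by linarith), fun s hs ↦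
    Real.smoothTransition.zero_of_nonpos (by linarith)⟩

/-- **Helper `helper_flatCorrector_noncompact`** (line `collapsed-ends-usc`, v13; see the module docstring):
reduction of the Cauchy problem `∂ₛw = Δ_g w − Qw`, `w(0) = w₀ ∈ C_c^∞` on a (non-compact) manifold to a
problem with a smooth forcing supported in `K × [0, 1]`, `K` compact: `W`, `G` smooth on `M × ℝ`, `W(0) = w₀`,
`W = G = 0` off `K` and for `s ≥ 1`, `G = 0` for `s ≤ 0`, `G = −(∂ₛW − Δ_g W + QW)` for `s ≥ 0`.
[cite: Treves1975, §41] -/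
theorem helper_flatCorrector_noncompact : ∀ (n : ℕ) (M : Type*) [TopologicalSpace M] [T2Space M] [SecondCountableTopology M] [ChartedSpace (EuclideanSpace ℝ (Fin n)) M] [IsManifold (𝓡 n) ∞ M] (g : PseudoRiemannianMetric (𝓡 n) ∞ (EuclideanSpace ℝ (Fin n)) (TangentSpace (𝓡 n) : M → Type _)) (Q : ℝ → M → ℝ), ContMDiff ((𝓡 n).prod 𝓘(ℝ, ℝ)) 𝓘(ℝ, ℝ) ∞ (fun p : M × ℝ ↦ Q p.2 p.1) → ∀ (w₀ : M → ℝ), ContMDiff (𝓡 n) 𝓘(ℝ, ℝ) ∞ w₀ → HasCompactSupport w₀ → ∃ (W G : ℝ → M → ℝ) (K : Set M), IsCompact K ∧ ContMDiff ((𝓡 n).prod 𝓘(ℝ, ℝ)) 𝓘(ℝ, ℝ) ∞ (fun p : M × ℝ ↦ W p.2 p.1) ∧ ContMDiff ((𝓡 n).prod 𝓘(ℝ, ℝ)) 𝓘(ℝ, ℝ) ∞ (fun p : M × ℝ ↦ G p.2 p.1) ∧ W 0 = w₀ ∧ (∀ s x, x ∉ K → W s x = 0) ∧ (∀ s x, x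 ∉ K → G s x = 0) ∧ (∀ s, 1 ≤ s → ∀ x, W s x = 0 ∧ G s x = 0) ∧ (∀ s ≤ 0, ∀ x, G s x = 0) ∧ ∀ s, 0 ≤ s → ∀ x, G s x = -(deriv (fun r ↦ W r x) s - (g.laplaceBeltrami (W s) x - Q s x * W s x)) := by
  intro n M _ _ _ _ _ g Q hQ w₀ hw₀ hw₀c
  classical
  haveI : LocallyCompactSpace M := ChartedSpace.locallyCompactSpace (EuclideanSpace ℝ (Fin n)) M
  haveI := g.hasLeviCivita
  set h : ℝ → PseudoRiemannianMetric (𝓡 n) ∞ (EuclideanSpace ℝ (Fin n)) (TangentSpace (𝓡 n) : M → Type _) :=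
    fun _ ↦ g with hh'
  have hh : IsContMDiffFamilyOn ∞ h univ := isContMDiffFamilyOn_const g univ
  -- Borel's lemma on the compact support of the datum, with the jets of the formal solution
  obtain ⟨W₁, K, hKc, hW₁s, hW₁jet, hW₁K⟩ :=
    exists_contMDiff_forall_iteratedDeriv_eq_of_isCompact (I := 𝓡 n) hw₀c.isCompact
      (a := heatJet (heatOp h Q) w₀) (contMDiff_heatJet hh hQ hw₀)
      (fun k x hx ↦ heatJet_eq_zero_of_notMem_tsupport g Q w₀ k x hx)
  -- the time cut-off
  obtain ⟨θ, hθs, hθ1, hθ0⟩ := exists_timeCutoff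
  set W : ℝ → M → ℝ := fun s x ↦ θ s * W₁ s x with hWdef
  have hWs : ContMDiff ((𝓡 n).prod 𝓘(ℝ, ℝ)) 𝓘(ℝ, ℝ) ∞ (fun p : M × ℝ ↦ W p.2 p.1) :=
    ((contMDiff_iff_contDiff.2 hθs).comp contMDiff_snd).mul hW₁s
  have hWev : ∀ x, (fun s ↦ W s x) =ᶠ[𝓝 0] fun s ↦ W₁ s x := fun x ↦ by
    filter_upwards [Iio_mem_nhds (by norm_num : (0 : ℝ) < 1 / 2)] with s hs
    simp [hWdef, hθ1 s hs.le]
  have hWjet : ∀ (k : ℕ) (x : M), iteratedDeriv k (fun s ↦ W s x) 0 = heatJet (heatOp h Q) w₀ k x :=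
    fun k x ↦ by rw [(hWev x).iteratedDeriv_eq, hW₁jet k x]
  have hWK : ∀ s x, x ∉ K → W s x = 0 := fun s x hx ↦ by simp [hWdef, hW₁K s x hx]
  have hW1 : ∀ s, 1 ≤ s → ∀ x, W s x = 0 := fun s hs x ↦ by simp [hWdef, hθ0 s hs]
  -- the residual and its flatness
  set F : ℝ → M → ℝ := fun s x ↦ -(deriv (fun r ↦ W r x) s - heatOp h Q s (W s) x) with hF
  have hFs : ContMDiff ((𝓡 n).prod 𝓘(ℝ, ℝ)) 𝓘(ℝ, ℝ) ∞ (fun p : M × ℝ ↦ F p.2 p.1) := by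
    have h1 : ContMDiff ((𝓡 n).prod 𝓘(ℝ, ℝ)) 𝓘(ℝ, ℝ) ∞
        (fun p : M × ℝ ↦ deriv (fun r ↦ W r p.1) p.2) := by
      have := contMDiff_iteratedDeriv_time hWs 1
      simpa only [iteratedDeriv_one] using this
    exact (h1.sub (contMDiff_heatOp' hh hQ hWs)).neg
  have hFflat : ∀ (x : M) (i : ℕ), iteratedDeriv i (fun s ↦ F s x) 0 = 0 := by
    intro x i
    have h1 : (fun s ↦ F s x) = fun s ↦ -(deriv (fun r ↦ W r x) s - heatOp h Q s (W s) x) := rfl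
    rw [h1, iteratedDeriv_fun_neg, iteratedDeriv_residual_eq_zero hh hQ hw₀ hWs hWjet x i, neg_zero]
  -- the residual vanishes off `K` and for `s ≥ 1`
  have hFzero : ∀ s x, (∀ᶠ y in 𝓝 x, ∀ r, W r y = 0) → F s x = 0 := by
    intro s x hx
    have hx0 : ∀ r, W r x = 0 := fun r ↦ hx.self_of_nhds r
    have hd : deriv (fun r ↦ W r x) s = 0 := by
      have : (fun r ↦ W r x) = fun _ ↦ (0 : ℝ) := funext hx0
      rw [this, deriv_const]
    have hL : heatOp h Q s (W s) x = 0 := by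
      rw [heatOp_apply, hx0 s, mul_zero, sub_zero]
      show g.laplaceBeltrami (W s) x = 0
      rw [laplaceBeltrami_eq_dalembertian]
      exact g.dalembertian_eq_zero_of_eventuallyEq_zero (hx.mono fun y hy ↦ hy s)
    show -(deriv (fun r ↦ W r x) s - heatOp h Q s (W s) x) = 0
    rw [hd, hL]; simp
  have hFK : ∀ s x, x ∉ K → F s x = 0 := fun s x hx ↦ by
    refine hFzero s x ?_
    filter_upwards [hKc.isClosed.isOpen_compl.mem_nhds hx] with y hy r using hWK r y hy
  have hFtime : ∀ s x, (∀ᶠ r in 𝓝 s, ∀ y, W r y = 0) → F s x = 0 := by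
    intro s x hs
    have hs0 : ∀ y, W s y = 0 := hs.self_of_nhds
    have hd : deriv (fun r ↦ W r x) s = 0 := by
      rw [Filter.EventuallyEq.deriv_eq (hs.mono fun r hr ↦ hr x)]
      exact deriv_const s 0
    have hL : heatOp h Q s (W s) x = 0 := by
      have : W s = fun _ ↦ (0 : ℝ) := funext hs0
      rw [heatOp_apply, this]
      show g.laplaceBeltrami (fun _ : M ↦ (0 : ℝ)) x - Q s x * 0 = 0
      rw [mul_zero, sub_zero, laplaceBeltrami_eq_dalembertian]
      exact g.dalembertian_eq_zero_of_eventuallyEq_zero (Eventually.of_forall fun _ ↦ rfl)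
    show -(deriv (fun r ↦ W r x) s - heatOp h Q s (W s) x) = 0
    rw [hd, hL]; simp
  have hF1 : ∀ s, 1 < s → ∀ x, F s x = 0 := fun s hs x ↦ by
    refine hFtime s x ?_
    filter_upwards [Ioi_mem_nhds hs] with r hr y using hW1 r hr.le y
  -- the forcing `G = 1_{s > 0} F`
  refine ⟨W, fun s x ↦ if 0 < s then F s x else 0, K, hKc, hWs, contMDiff_timeCutoff_manifold hFs hFflat,
    ?_, hWK, ?_, ?_, ?_, ?_⟩
  · funext x
    have := hWjet 0 x
    rw [iteratedDeriv_zero, heatJet_zero] at this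
    exact this
  · intro s x hx
    by_cases hs : 0 < s
    · simp [hs, hFK s x hx]
    · simp [hs]
  · intro s hs x
    refine ⟨hW1 s hs x, ?_⟩
    rcases hs.lt_or_eq with hs' | rfl
    · simp [hF1 s hs' x]
    · -- at `s = 1`: `F 1 x = 0` by continuity from the right
      have hcont : Continuous fun r ↦ F r x :=
        (contDiff_time_slice hFs x).continuous
      have hlim : Tendsto (fun r ↦ F r x) (𝓝[>] 1) (𝓝 (F 1 x)) := hcont.continuousAt.continuousWithinAt
      have hev : (fun r ↦ F r x) =ᶠ[𝓝[>] 1] fun _ ↦ 0 := by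
        filter_upwards [self_mem_nhdsWithin] with r hr using hF1 r hr x
      have h0 : F 1 x = 0 := tendsto_nhds_unique hlim (tendsto_const_nhds.congr' hev.symm)
      simp [h0]
  · intro s hs x
    simp [not_lt.2 hs]
  · intro s hs x
    rcases hs.lt_or_eq with hs' | rfl
    · simp [hs', hF, hh']
    · have := hFflat x 0
      rw [iteratedDeriv_zero] at this
      simp only [hF, heatOp_apply] at this
      simp only [lt_irrefl, if_false]
      show (0 : ℝ) = -(deriv (fun r ↦ W r x) 0 - (g.laplaceBeltrami (W 0) x - Q 0 x * W 0 x))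
      linarith

end Corrector

end Literature.Geometry.Riemannian.NoncompactShrinkerGapHeat

end Part7

/-!
## Part 8 — port of `Summits/SmoothPoincare4/SmoothPoincare4/Theorems/EntropyRungBakryEmeryLogSobolevFlowExistence.lean` (1 declarations kept)

# Existence of the weighted heat flow `∂ₛρ = Δ_g ρ − g⁻¹(dV, dρ)` from data constant outside a compact set on
# a complete weighted manifold with ARBITRARY smooth weight

`weightedHeatFlow_exists_gaffney`: on `M` modelled on `ℝⁿ` (Hausdorff, second countable, `T₃`, Borel — NOT
compact) with `g` Riemannian (Levi-Civita connection), `V` smooth (NO further assumption) and Gaffney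
cut-offs, for `c₀ ∈ ℝ`, `ψ₀ ∈ C_c^∞` and `T > 0` there are an open `O ⊇ [0, T]` and `ρ` smooth on `M × O`
with `ρ(0) = c₀ + ψ₀`, `∂ₛρ = Δ_g ρ − g⁻¹(dV, dρ)` on `[0, T]` and `(ρ − c₀)² e^{-V} ∈ L¹(M × (0, T))` — the
`𝕃²(e^{-V}dV_g)` heat flow, i.e. the minimal heat semigroup `P_T(c₀ + ψ₀)` of the weighted manifold
(Bakry–Gentil–Ledoux 2014, §3.2.3; Grigor'yan 2009, Ch. 7–8). This is the shrinker toolkit's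
`helper_heatFlowExistence_of` (`Summits/…/EntropyRungNoncompactShrinkerGapHeatFlowExistence.lean`: ground-state transform `ρ = c₀ + e^{V/2}e^{s}w`, `heatDrift_of_potential`,
the flat corrector `helper_flatCorrector_noncompact`) with the linear Cauchy solver `linearHeat_cauchy_gaffney`,
which needs no lower bound on `¼|∇V|² − ½ΔV`. Everything is proved; no definitions, no named facts.

## References

* [BakryGentilLedoux2014] D. Bakry, I. Gentil, M. Ledoux (2014), §3.2.3 (p. 142) and §1.15.7.
* [Grigoryan2009] A. Grigor'yan, *Heat Kernel and Analysis on Manifolds* (2009), Ch. 7–8.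
* [Treves1975] F. Trèves (1975), §41, Thm. 40.1.
-/

section Part8

open scoped _root_.Manifold _root_.ContDiff _root_.ENNReal _root_.NNReal _root_.Topology
open _root_.MeasureTheory _root_.Set _root_.Filter
open Literature.Geometry.Lorentzian Literature.Geometry.Riemannian

namespace Literature.Geometry.Riemannian.BakryEmeryComplete

open NoncompactShrinkerGapHeat

section Flow

variable {n : ℕ} {M : Type*} [TopologicalSpace M] [T2Space M] [SecondCountableTopology M]
  [ChartedSpace (EuclideanSpace ℝ (Fin n)) M] [IsManifold (𝓡 n) ∞ M] [T3Space M] [MeasurableSpace M]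
  [BorelSpace M]
  {g : PseudoRiemannianMetric (𝓡 n) ∞ (EuclideanSpace ℝ (Fin n)) (TangentSpace (𝓡 n) : M → Type _)}
  [g.HasLeviCivita]

/-- **Existence of the weighted heat flow from `c₀ + ψ₀`, `ψ₀ ∈ C_c^∞`, on a complete weighted manifold with
arbitrary smooth weight** (see the module docstring). [cite: BakryGentilLedoux2014, §3.2.3 (p. 142)]
[cite: Grigoryan2009, Ch. 7] [cite: Treves1975, §41, Thm. 40.1] -/
theorem weightedHeatFlow_exists_gaffney (hg : g.IsRiemannian) {V : M → ℝ} (hV : ContMDiff (𝓡 n) 𝓘(ℝ, ℝ) ∞ V)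
    {η : ℕ → M → ℝ} {C₀ : ℝ} (hηs : ∀ k, ContMDiff (𝓡 n) 𝓘(ℝ, ℝ) ∞ (η k))
    (hηc : ∀ k, HasCompactSupport (η k)) (hη01 : ∀ k x, 0 ≤ η k x ∧ η k x ≤ 1)
    (hηmono : ∀ k x, η k x ≤ η (k + 1) x) (hη1 : ∀ x, ∀ᶠ k in atTop, η k x = 1)
    (hηgrad : ∀ k x, g.gradSq (η k) x ≤ C₀ / ((k : ℝ) + 1) ^ 2)
    (c₀ : ℝ) {ψ₀ : M → ℝ} (hψ : ContMDiff (𝓡 n) 𝓘(ℝ, ℝ) ∞ ψ₀) (hψc : HasCompactSupport ψ₀) {T : ℝ}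
    (hT : 0 < T) :
    ∃ (O : Set ℝ) (ρ : ℝ → M → ℝ), IsOpen O ∧ Icc 0 T ⊆ O ∧
      ContMDiffOn ((𝓡 n).prod 𝓘(ℝ, ℝ)) 𝓘(ℝ, ℝ) ∞ (fun p : M × ℝ ↦ ρ p.2 p.1) (univ ×ˢ O) ∧
      (∀ x, ρ 0 x = c₀ + ψ₀ x) ∧
      (∀ s ∈ Icc 0 T, ∀ x, deriv (fun r ↦ ρ r x) s = g.dalembertian (ρ s) x
        - g.innerDual x (mvfderiv (𝓡 n) V x).toLinearMap (mvfderiv (𝓡 n) (ρ s) x).toLinearMap) ∧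
      Integrable (fun p : M × ℝ ↦ (ρ p.2 p.1 - c₀) ^ 2 * Real.exp (-V p.1))
        ((g.riemVolume.prod (volume : Measure ℝ)).restrict (univ ×ˢ Ioo 0 T)) := by
  classical
  -- the potential `Q = ¼|∇V|² − ½ΔV + 1` (time independent; NO lower bound)
  set Q : ℝ → M → ℝ := fun _ x ↦ g.gradSq V x / 4 - g.dalembertian V x / 2 + 1 with hQdef
  have hQs : ContMDiff ((𝓡 n).prod 𝓘(ℝ, ℝ)) 𝓘(ℝ, ℝ) ∞ (fun p : M × ℝ ↦ Q p.2 p.1) := by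
    have h1 : ContMDiff (𝓡 n) 𝓘(ℝ, ℝ) ∞ (fun x ↦ g.gradSq V x / 4 - g.dalembertian V x / 2 + 1) :=
      (((contMDiff_gradSq g hV).div_const 4).sub ((contMDiff_dalembertian g hV).div_const 2)).add
        contMDiff_const
    exact h1.comp contMDiff_fst
  -- the datum `w₀ = e^{-V/2} ψ₀`
  set w₀ : M → ℝ := fun x ↦ Real.exp (-(V x / 2)) * ψ₀ x with hw₀def
  have hw₀ : ContMDiff (𝓡 n) 𝓘(ℝ, ℝ) ∞ w₀ :=
    ((contMDiff_iff_contDiff.2 Real.contDiff_exp).comp (hV.div_const 2).neg).mul hψ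
  have hw₀c : HasCompactSupport w₀ := hψc.mul_left
  -- the flat corrector and the linear Cauchy problem
  obtain ⟨W, G, K, hK, hW, hG, hW0, hWK, hGK, hWG1, hG0, hGW⟩ :=
    helper_flatCorrector_noncompact n M g Q hQs w₀ hw₀ hw₀c
  obtain ⟨O, w, hO, hTO, hws, hw0, hweq, hwL2⟩ :=
    linearHeat_cauchy_gaffney hg hV hηs hηc hη01 hηmono hη1 hηgrad hK hW hG hWK hGK hWG1 hG0 hGW hT
  -- the candidate `ρ = c₀ + e^{V/2} e^{s} w`
  set lam : ℝ := 1 with hlamdef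
  set u : ℝ → M → ℝ := fun s x ↦ Real.exp (V x / 2) * (Real.exp (lam * s) * w s x) with hudef
  set ρ : ℝ → M → ℝ := fun s x ↦ 1 * u s x + c₀ with hρdef
  have hus : ContMDiffOn ((𝓡 n).prod 𝓘(ℝ, ℝ)) 𝓘(ℝ, ℝ) ∞ (fun p : M × ℝ ↦ u p.2 p.1) (univ ×ˢ O) := by
    have hE : ContMDiff ((𝓡 n).prod 𝓘(ℝ, ℝ)) 𝓘(ℝ, ℝ) ∞ (fun p : M × ℝ ↦ Real.exp (V p.1 / 2)) :=
      ((contMDiff_iff_contDiff.2 Real.contDiff_exp).comp ((hV.comp contMDiff_fst).div_const 2))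
    have hL : ContMDiff ((𝓡 n).prod 𝓘(ℝ, ℝ)) 𝓘(ℝ, ℝ) ∞ (fun p : M × ℝ ↦ Real.exp (lam * p.2)) :=
      (contMDiff_iff_contDiff.2 Real.contDiff_exp).comp (contMDiff_const.mul contMDiff_snd)
    exact hE.contMDiffOn.mul (hL.contMDiffOn.mul hws)
  have hρs : ContMDiffOn ((𝓡 n).prod 𝓘(ℝ, ℝ)) 𝓘(ℝ, ℝ) ∞ (fun p : M × ℝ ↦ ρ p.2 p.1) (univ ×ˢ O) :=
    (contMDiffOn_const.mul hus).add contMDiffOn_const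
  refine ⟨O, ρ, hO, hTO, hρs, fun x ↦ ?_, fun s hs x ↦ ?_, ?_⟩
  · -- `ρ(0) = c₀ + ψ₀`
    have h1 : Real.exp (V x / 2) * Real.exp (-(V x / 2)) = 1 := by
      rw [← Real.exp_add]; simp
    simp only [hρdef, hudef, hw0, hW0, hw₀def, mul_zero, Real.exp_zero, one_mul]
    calc Real.exp (V x / 2) * (Real.exp (-(V x / 2)) * ψ₀ x) + c₀
        = (Real.exp (V x / 2) * Real.exp (-(V x / 2))) * ψ₀ x + c₀ := by ring
      _ = c₀ + ψ₀ x := by rw [h1]; ring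
  · -- the equation: exponential shift, then conjugation by `e^{V/2}`
    have hsO : s ∈ O := hTO hs
    have h2 : (2 : ℕ∞ω) ≤ (∞ : ℕ∞ω) := by norm_cast
    have hslice : ContMDiff (𝓡 n) 𝓘(ℝ, ℝ) ∞ (w s) :=
      hws.comp_contMDiff (contMDiff_id.prodMk contMDiff_const) fun y ↦ ⟨mem_univ _, hsO⟩
    have hws2 : ContMDiffAt (𝓡 n) 𝓘(ℝ, ℝ) 2 (w s) x := (hslice.of_le h2).contMDiffAt
    -- the shifted function `w̃ = e^{λ s} w`
    set wt : ℝ → M → ℝ := fun r y ↦ Real.exp (lam * r) * w r y with hwtdef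
    have hwt2 : ContMDiffAt (𝓡 n) 𝓘(ℝ, ℝ) 2 (wt s) x := (contMDiffAt_const.mul hws2 :)
    have hdw : HasDerivAt (fun r ↦ w r x) (g.dalembertian (w s) x - Q s x * w s x) s := by
      have h := CutoffToolkit.hasDerivAt_time hO hws x hsO
      rw [hweq s hs x] at h
      exact h
    have hdE : HasDerivAt (fun r : ℝ ↦ Real.exp (lam * r)) (lam * Real.exp (lam * s)) s := by
      have := ((hasDerivAt_id s).const_mul lam).exp
      simpa [mul_comm] using this
    have hdwt : HasDerivAt (fun r ↦ wt r x)
        (g.dalembertian (wt s) x - (g.gradSq V x / 4 - g.dalembertian V x / 2) * wt s x) s := by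
      have h := hdE.mul hdw
      have hΔ : g.dalembertian (wt s) x = Real.exp (lam * s) * g.dalembertian (w s) x := by
        show g.dalembertian (fun y ↦ Real.exp (lam * s) * w s y) x = _
        exact g.dalembertian_const_mul_of_contMDiffAt hws2 _
      rw [hΔ]
      refine h.congr_deriv ?_
      simp only [hwtdef, hQdef, hlamdef]
      ring
    have hconj := heatDrift_of_potential g hV (S := univ) hwt2 hdwt.hasDerivWithinAt
    have hdu : HasDerivAt (fun r ↦ u r x)
        (g.dalembertian (u s) x - g.innerDual x (mvfderiv (𝓡 n) V x).toLinearMap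
          (mvfderiv (𝓡 n) (u s) x).toLinearMap) s := by
      have h := hconj.hasDerivAt (Filter.univ_mem)
      simpa [hudef, hwtdef] using h
    have hdρ : HasDerivAt (fun r ↦ ρ r x)
        (1 * (g.dalembertian (u s) x - g.innerDual x (mvfderiv (𝓡 n) V x).toLinearMap
          (mvfderiv (𝓡 n) (u s) x).toLinearMap)) s := by
      have := (hdu.const_mul 1).add_const c₀
      simpa [hρdef] using this
    rw [hdρ.deriv]
    have hu2 : ContMDiffAt (𝓡 n) 𝓘(ℝ, ℝ) 2 (u s) x := by
      have hA : ContMDiffAt (𝓡 n) 𝓘(ℝ, ℝ) 2 (fun y ↦ Real.exp (V y / 2)) x :=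
        (((contMDiff_iff_contDiff.2 Real.contDiff_exp).comp (hV.div_const 2)).of_le h2).contMDiffAt
      exact hA.mul hwt2
    have haff := weightedLaplacian_affine (g := g) (V := V) hu2 1 c₀
    rw [show ρ s = fun y ↦ 1 * u s y + c₀ from rfl, haff]
  · -- `(ρ − c₀)² e^{-V} = e^{2λs} w² ≤ e^{2|λ|T} w²` on the strip
    have hmeasS : MeasurableSet ((univ : Set M) ×ˢ Ioo (0 : ℝ) T) := MeasurableSet.univ.prod measurableSet_Ioo
    refine (hwL2.const_mul (Real.exp (2 * |lam| * T))).mono' ?_ ?_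
    · have hsub : (univ : Set M) ×ˢ Ioo (0 : ℝ) T ⊆ univ ×ˢ O :=
        Set.prod_mono le_rfl fun s hs ↦ hTO (Ioo_subset_Icc_self hs)
      have hρc : ContinuousOn (fun p : M × ℝ ↦ ρ p.2 p.1) ((univ : Set M) ×ˢ Ioo (0 : ℝ) T) :=
        hρs.continuousOn.mono hsub
      have hc : ContinuousOn (fun p : M × ℝ ↦ (ρ p.2 p.1 - c₀) ^ 2 * Real.exp (-V p.1))
          ((univ : Set M) ×ˢ Ioo (0 : ℝ) T) :=
        ((hρc.sub continuousOn_const).pow 2).mul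
          (Real.continuous_exp.comp (hV.continuous.comp continuous_fst).neg).continuousOn
      exact hc.aestronglyMeasurable hmeasS
    · rw [ae_restrict_iff' hmeasS]
      refine Eventually.of_forall fun p hp ↦ ?_
      obtain ⟨-, hs⟩ := hp
      have h1 : (ρ p.2 p.1 - c₀) ^ 2 * Real.exp (-V p.1) = Real.exp (2 * (lam * p.2)) * w p.2 p.1 ^ 2 := by
        simp only [hρdef, hudef]
        have hE : Real.exp (V p.1 / 2) ^ 2 * Real.exp (-V p.1) = 1 := by
          rw [sq, ← Real.exp_add, ← Real.exp_add]
          convert Real.exp_zero using 2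
          ring
        have hL : Real.exp (lam * p.2) ^ 2 = Real.exp (2 * (lam * p.2)) := by
          rw [sq, ← Real.exp_add]
          congr 1
          ring
        calc (1 * (Real.exp (V p.1 / 2) * (Real.exp (lam * p.2) * w p.2 p.1)) + c₀ - c₀) ^ 2 * Real.exp (-V p.1)
            = (Real.exp (V p.1 / 2) ^ 2 * Real.exp (-V p.1)) * (Real.exp (lam * p.2) ^ 2 * w p.2 p.1 ^ 2) := by
              ring
          _ = Real.exp (2 * (lam * p.2)) * w p.2 p.1 ^ 2 := by rw [hE, hL, one_mul]
      rw [Real.norm_eq_abs, h1, abs_of_nonneg (by positivity)]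
      refine mul_le_mul_of_nonneg_right (Real.exp_le_exp.2 ?_) (sq_nonneg _)
      have h3 : lam * p.2 ≤ |lam| * T := by
        calc lam * p.2 ≤ |lam| * p.2 := mul_le_mul_of_nonneg_right (le_abs_self _) hs.1.le
          _ ≤ |lam| * T := mul_le_mul_of_nonneg_left hs.2.le (abs_nonneg _)
      linarith

end Flow

end Literature.Geometry.Riemannian.BakryEmeryComplete

end Part8

/-!
## Part 9 — port of `Summits/SmoothPoincare4/SmoothPoincare4/Theorems/EntropyRungBakryEmeryLogSobolevComplete.lean` (1 declarations kept)

# The Bakry–Émery logarithmic Sobolev inequality on a complete `CD(K,∞)` weighted manifold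

On a connected complete Riemannian manifold `(M, g)` modelled on `ℝⁿ` with `V` smooth,
`Ric_g + Hess V ≥ K g`, `K > 0`, `∫ e^{-V} dV_g = 1`:
`∫ φ e^φ e^{-V} ≤ (2K)⁻¹ ∫ |∇φ|² e^φ e^{-V}` for every smooth `φ` with `∫ e^φ e^{-V} = 1` (and the
integrability provisos of the named fact). NO growth condition on `V` is assumed: the heat flow is the
energy-class flow of `EntropyRungBakryEmeryLogSobolevFlowExistence.lean` (ground-state transform with the
potential `¼|∇V|² − ½ΔV + 1`, perfect-square coercivity, Lions' very weak solutions, hypoellipticity),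
and every step of the Bakry–Émery argument is run with FIRST-ORDER Gaffney cut-offs only
(`|∇η_k|² ≤ C₀/(k+1)²`; no bound on `Lη_k` exists in this generality):

* `logSobolev_eventuallyConst_gaffney` — the inequality for `φ` smooth and constant outside a compact
  set: with `f = e^φ = c + ψ`, `ψ ∈ C_c^∞`, the flow `u_T` on `[0, T]` from `f`
  (`weightedHeatFlow_exists_gaffney`), `a ≤ u_T ≤ b` and `|∇u_T(s)|² ≤ e^{-2Ks} sup|∇f|²`
  (`gaffney_apriori`), unit mass (`gaffney_massConservation`),
  `H(f) − H(u_T(T)) ≤ I(f)/2K` (`gaffney_entropyProduction`), and `H(u_T(T)) → 0` as `T → ∞`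
  (`tendsto_entropy_complete`, which only uses the slices `u_T(T)`).
* `bakryEmery_logSobolev_complete_holds` — the named fact `bakryEmery_logSobolev_complete`
  (density step `bakryEmery_logSobolev_complete_of_eventuallyConst`).
* `bakryEmeryLogSobolev_proof` — the route's support statement, by `bakryEmeryLogSobolev_of_fact`.

## References

* [BakryGentilLedoux2014] D. Bakry, I. Gentil, M. Ledoux, *Analysis and Geometry of Markov Diffusion
  Operators* (2014), Thm. 5.2.1, Prop. 5.7.1, Cor. 5.7.2 (pp. 236–240, 268), §3.2 (pp. 141–148).
* [BakryEmery1985] D. Bakry, M. Émery, *Diffusions hypercontractives* (1985).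
* [CarrilloNi2009] J. A. Carrillo, L. Ni, Comm. Anal. Geom. 17 (2009), Thm. 3.1 (p. 7).
* [Grigoryan2009] A. Grigor'yan, *Heat Kernel and Analysis on Manifolds* (2009), Ch. 7, §11.4, §12.1.
-/

section Part9

open scoped _root_.Manifold _root_.ContDiff _root_.ENNReal _root_.NNReal _root_.Topology
open _root_.MeasureTheory _root_.Set _root_.Filter
open Literature.Geometry.Lorentzian Literature.Geometry.Riemannian

namespace Literature.Geometry.Riemannian.BakryEmeryComplete

open NoncompactShrinkerGapHeat NoncompactShrinkerGapHeat.CutoffToolkit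

section Assembly

variable {n : ℕ} {M : Type} [TopologicalSpace M] [T2Space M] [SecondCountableTopology M]
  [ChartedSpace (EuclideanSpace ℝ (Fin n)) M] [IsManifold (𝓡 n) ∞ M] [ConnectedSpace M] [T3Space M]
  [MeasurableSpace M] [BorelSpace M]
  {g : PseudoRiemannianMetric (𝓡 n) ∞ (EuclideanSpace ℝ (Fin n)) (TangentSpace (𝓡 n) : M → Type _)}
  [g.HasLeviCivita]

/-- **The logarithmic Sobolev inequality of a complete `CD(K,∞)` weighted manifold for smooth `φ`
constant outside a compact set** (Bakry–Émery along the energy-class heat flow with Gaffney cut-offs;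
see the module docstring): `∫ φ e^φ e^{-V} ≤ (2K)⁻¹ ∫ |∇φ|² e^φ e^{-V}` when `∫ e^φ e^{-V} = 1 = ∫ e^{-V}`.
[cite: BakryGentilLedoux2014, Prop. 5.7.1 (p. 268), Thm. 5.2.1 (p. 238), §3.2 (pp. 141–148)]
[cite: BakryEmery1985] [cite: CarrilloNi2009, Thm. 3.1 (p. 7)] -/
theorem logSobolev_eventuallyConst_gaffney (hg : g.IsRiemannian)
    (hc : ∀ (x : M) (r : NNReal), IsCompact {y : M | g.edist hg x y ≤ r})
    {V : M → ℝ} (hV : ContMDiff (𝓡 n) 𝓘(ℝ, ℝ) ∞ V) {K : ℝ} (hK : 0 < K)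
    (hRic : ∀ (x : M) (X : TangentSpace (𝓡 n) x), K * g.val x X X ≤ g.ricci x X X + g.hessian V x X X)
    (hmass : ∫ x, Real.exp (-V x) ∂g.riemVolume = 1)
    (φ : M → ℝ) (hφ : ContMDiff (𝓡 n) 𝓘(ℝ, ℝ) ∞ φ)
    (hφK : ∃ K₀ : Set M, IsCompact K₀ ∧ ∃ c : ℝ, ∀ x, x ∉ K₀ → φ x = c)
    (hφmass : ∫ x, Real.exp (φ x) * Real.exp (-V x) ∂g.riemVolume = 1) :
    ∫ x, φ x * (Real.exp (φ x) * Real.exp (-V x)) ∂g.riemVolume ≤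
      1 / (2 * K) * ∫ x, g.gradSq φ x * (Real.exp (φ x) * Real.exp (-V x)) ∂g.riemVolume := by
  haveI : Nonempty M := ConnectedSpace.toNonempty
  obtain ⟨o⟩ := ‹Nonempty M›
  haveI := CarrilloNi2009_shrinkerLSI.isFiniteMeasureOnCompacts_riemVolume hg
  set μ : Measure M := g.riemVolume with hμ
  obtain ⟨K₀, hK₀, cφ, hcφ⟩ := hφK
  have hw : Integrable (fun x ↦ Real.exp (-V x)) μ := by
    by_contra h'; rw [integral_undef h'] at hmass; exact zero_ne_one hmass
  have hexpc : Continuous fun y ↦ Real.exp (-V y) := Real.continuous_exp.comp hV.continuous.neg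
  -- Gaffney cut-offs
  obtain ⟨η, C₀, hηs, hηc, hη01, hηmono, hη1, hηgrad⟩ := exists_gaffney_cutoff hg hc
  /- the datum `f = e^φ`, its bounds `a ≤ f ≤ b`, the constant `c = e^{cφ}` at infinity -/
  set f : M → ℝ := fun x ↦ Real.exp (φ x) with hfdef
  have hf : ContMDiff (𝓡 n) 𝓘(ℝ, ℝ) ∞ f := Real.contDiff_exp.comp_contMDiff hφ
  obtain ⟨C₁, hC₁⟩ := exists_forall_abs_le_of_eventuallyConst hφ.continuous ⟨K₀, hK₀, cφ, hcφ⟩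
  set Cφ : ℝ := max C₁ |cφ| with hCφdef
  have hCφ : ∀ x, |φ x| ≤ Cφ := fun x ↦ (hC₁ x).trans (le_max_left _ _)
  have hcφC : |cφ| ≤ Cφ := le_max_right _ _
  set a : ℝ := Real.exp (-Cφ) with hadef
  set b : ℝ := Real.exp Cφ with hbdef
  set c : ℝ := Real.exp cφ with hcdef
  have ha : 0 < a := Real.exp_pos _
  have hfa : ∀ x, a ≤ f x := fun x ↦ Real.exp_le_exp.2 (neg_le_of_abs_le (hCφ x))
  have hfb : ∀ x, f x ≤ b := fun x ↦ Real.exp_le_exp.2 (le_of_abs_le (hCφ x))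
  have hac : a ≤ c := Real.exp_le_exp.2 (neg_le_of_abs_le hcφC)
  have hcb : c ≤ b := Real.exp_le_exp.2 (le_of_abs_le hcφC)
  -- `|∇f|² = f² |∇φ|² ≤ CΓf`
  have hΓφc : Continuous (g.gradSq φ) := (contMDiff_gradSq g hφ).continuous
  obtain ⟨CΓφ, hCΓφ⟩ := exists_forall_abs_le_of_eventuallyConst hΓφc ⟨K₀, hK₀, 0, fun x hx ↦
    g.gradSq_eq_zero_of_mvfderiv_eq_zero (mvfderiv_eq_zero_of_eventuallyConst hK₀ hcφ hx)⟩
  have hΓf : ∀ x, g.gradSq f x = f x ^ 2 * g.gradSq φ x := fun x ↦ by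
    have hh : HasDerivAt Real.exp (Real.exp (φ x)) (φ x) := Real.hasDerivAt_exp _
    exact g.gradSq_real_comp hh (hφ.mdifferentiableAt (by simp))
  set CΓf : ℝ := b ^ 2 * CΓφ with hCΓfdef
  have hΓfb : ∀ x, g.gradSq f x ≤ CΓf := fun x ↦ by
    rw [hΓf x]
    exact mul_le_mul (pow_le_pow_left₀ (Real.exp_pos _).le (hfb x) 2) ((le_abs_self _).trans (hCΓφ x))
      (g.gradSq_nonneg hg φ x) (sq_nonneg _)
  have hCΓf0 : 0 ≤ CΓf := (g.gradSq_nonneg hg f o).trans (hΓfb o)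
  -- `ψ = f − c ∈ C_c^∞`
  set ψ : M → ℝ := fun x ↦ f x - c with hψdef
  have hψ : ContMDiff (𝓡 n) 𝓘(ℝ, ℝ) ∞ ψ := hf.sub contMDiff_const
  have hψ0 : ∀ x, x ∉ K₀ → ψ x = 0 := fun x hx ↦ by simp only [hψdef, hfdef, hcφ x hx, hcdef, sub_self]
  have hψc : HasCompactSupport ψ := HasCompactSupport.intro hK₀ hψ0
  have h0int : Integrable (fun x ↦ ψ x ^ 2 * Real.exp (-V x)) μ := by
    have hsupp : HasCompactSupport (fun x ↦ ψ x ^ 2 * Real.exp (-V x)) := by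
      refine HasCompactSupport.intro hK₀ fun x hx ↦ ?_
      rw [hψ0 x hx]
      ring
    exact integrable_of_continuous_of_hasCompactSupport' hg ((hψ.continuous.pow 2).mul hexpc) hsupp
  -- entropy and Fisher information of `f`
  set Hf : ℝ := ∫ x, f x * Real.log (f x) * Real.exp (-V x) ∂μ with hHfdef
  set If : ℝ := ∫ x, g.gradSq f x / f x * Real.exp (-V x) ∂μ with hIfdef
  /- the flow with horizon `T`: a-priori bounds, mass, entropy production -/
  have hflow : ∀ T : ℝ, 0 < T → ∃ uT : M → ℝ, ContMDiff (𝓡 n) 𝓘(ℝ, ℝ) ∞ uT ∧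
      (∀ x, a ≤ uT x ∧ uT x ≤ b) ∧ (∀ x, g.gradSq uT x ≤ Real.exp (-2 * K * T) * CΓf) ∧
      ∫ x, uT x * Real.exp (-V x) ∂μ = 1 ∧
      Hf - ∫ x, uT x * Real.log (uT x) * Real.exp (-V x) ∂μ ≤ 1 / (2 * K) * If := by
    intro T hT
    obtain ⟨O, u, hO, hTO, hu, hu0, heq, hint⟩ :=
      weightedHeatFlow_exists_gaffney hg hV hηs hηc hη01 hηmono hη1 hηgrad c hψ hψc hT
    have hu0f : u 0 = f := funext fun x ↦ by rw [hu0 x]; simp only [hψdef]; ring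
    have hTT : T ∈ Icc 0 T := ⟨hT.le, le_rfl⟩
    have h0ab : ∀ x, a ≤ u 0 x ∧ u 0 x ≤ b := fun x ↦ by rw [hu0f]; exact ⟨hfa x, hfb x⟩
    have hG₀ : ∀ x, g.gradSq (u 0) x ≤ CΓf := fun x ↦ by rw [hu0f]; exact hΓfb x
    have h0 : Integrable (fun x ↦ (u 0 x - c) ^ 2 * Real.exp (-V x)) μ := by
      rw [hu0f]
      exact h0int
    obtain ⟨hab, hgrad⟩ := gaffney_apriori hg hV hRic hηs hηc hη01 hηmono hη1 hηgrad hT hO hTO hu heq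
      hac hcb h0ab hG₀ hint h0
    have hgrad' : ∀ s ∈ Icc 0 T, ∀ x, g.gradSq (u s) x ≤ CΓf := fun s hs x ↦ by
      refine (hgrad s hs x).trans (mul_le_of_le_one_left hCΓf0 ?_)
      exact Real.exp_le_one_iff.2 (by nlinarith [hs.1, hK])
    have hB : ∀ s ∈ Icc 0 T, ∀ x, |u s x| ≤ b := fun s hs x ↦ by
      rw [abs_of_nonneg (ha.le.trans (hab s hs x).1)]
      exact (hab s hs x).2
    have hmassT : ∫ x, u T x * Real.exp (-V x) ∂μ = 1 := by
      rw [gaffney_massConservation hg hV hw hηs hηc hη01 hη1 hηgrad hO hTO hu heq hB hgrad' hTT, hu0f]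
      exact hφmass
    have hent := gaffney_entropyProduction hg hV hRic hK hw hηs hηc hη01 hη1 hηgrad hT hO hTO hu heq
      ha hab hgrad'
    rw [hu0f] at hent
    exact ⟨u T, contMDiff_slice_of_contMDiffOn hu (hTO hTT), hab T hTT, hgrad T hTT, hmassT, hent⟩
  choose uT huTs huTab huTgrad huTmass huTent using hflow
  /- the slices `U t = u_t(t)` (`t > 0`), `U t = f` (`t ≤ 0`), and `H(U t) → 0` -/
  set U : ℝ → M → ℝ := fun t ↦ if ht : 0 < t then uT t ht else f with hUdef
  have hUpos : ∀ t (ht : 0 < t), U t = uT t ht := fun t ht ↦ by simp only [hUdef, dif_pos ht]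
  have hUnp : ∀ t, ¬ 0 < t → U t = f := fun t ht ↦ by simp only [hUdef, dif_neg ht]
  have huc : ∀ t ∈ Ici (0 : ℝ), ContMDiff (𝓡 n) 𝓘(ℝ, ℝ) 1 (U t) := by
    intro t _ht
    by_cases h : 0 < t
    · rw [hUpos t h]; exact (huTs t h).of_le (by norm_num)
    · rw [hUnp t h]; exact hf.of_le (by norm_num)
  have habU : ∀ t ∈ Ici (0 : ℝ), ∀ x, a ≤ U t x ∧ U t x ≤ b := by
    intro t _ht x
    by_cases h : 0 < t
    · rw [hUpos t h]; exact huTab t h x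
    · rw [hUnp t h]; exact ⟨hfa x, hfb x⟩
  have hgradU : ∀ t ∈ Ici (0 : ℝ), ∀ x, g.gradSq (U t) x ≤ (Real.exp (-K * t)) ^ 2 * CΓf := by
    intro t ht x
    have hexp : Real.exp (-K * t) ^ 2 = Real.exp (-2 * K * t) := by
      rw [sq, ← Real.exp_add]; ring_nf
    rw [hexp]
    by_cases h : 0 < t
    · rw [hUpos t h]; exact huTgrad t h x
    · rw [hUnp t h]
      have ht0 : t = 0 := le_antisymm (not_lt.1 h) ht
      rw [ht0, mul_zero, Real.exp_zero, one_mul]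
      exact hΓfb x
  have hmassU : ∀ t ∈ Ici (0 : ℝ), ∫ x, U t x * Real.exp (-V x) ∂μ = 1 := by
    intro t _ht
    by_cases h : 0 < t
    · rw [hUpos t h]; exact huTmass t h
    · rw [hUnp t h]; exact hφmass
  have hlim := tendsto_entropy_complete hg hV hw hmass huc ha habU hK hCΓf0 hgradU hmassU
  -- `H(f) − I(f)/2K ≤ H(U t)` for `t > 0`, hence `≤ 0`
  have hev : ∀ᶠ t in atTop, Hf - 1 / (2 * K) * If ≤ ∫ x, U t x * Real.log (U t x) * Real.exp (-V x) ∂μ := by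
    filter_upwards [eventually_gt_atTop (0 : ℝ)] with t ht
    rw [hUpos t ht]
    linarith [huTent t ht]
  have hfin : Hf - 1 / (2 * K) * If ≤ 0 := ge_of_tendsto hlim hev
  /- identification of `H(f)` and `I(f)` -/
  have hH0 : Hf = ∫ x, φ x * (Real.exp (φ x) * Real.exp (-V x)) ∂μ := by
    rw [hHfdef]
    refine integral_congr_ae (Eventually.of_forall fun x ↦ ?_)
    simp only [hfdef, Real.log_exp]
    ring
  have hI0 : If = ∫ x, g.gradSq φ x * (Real.exp (φ x) * Real.exp (-V x)) ∂μ := by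
    rw [hIfdef]
    refine integral_congr_ae (Eventually.of_forall fun x ↦ ?_)
    dsimp only
    rw [hΓf x]
    simp only [hfdef]
    have hne : Real.exp (φ x) ≠ 0 := (Real.exp_pos _).ne'
    field_simp
  rw [hH0, hI0] at hfin
  linarith

end Assembly

/-! ### The named fact and the route item -/

end Literature.Geometry.Riemannian.BakryEmeryComplete

end Part9

/-! ## Part 10 — the EXACT discharge of `bakryEmery_logSobolev_complete` -/

namespace Literature.Geometry.Riemannian

open BakryEmeryComplete in
/-- **The named fact `bakryEmery_logSobolev_complete` HOLDS** (`BakryEmeryLogSobolev.lean`; Bakry–Émery 1985, Bakry–Gentil–Ledoux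
2014 Prop. 5.7.1 / Cor. 5.7.2, Carrillo–Ni 2009 Thm. 3.1): on a connected complete Riemannian manifold `(M, g)` modelled on `ℝⁿ`
with `V` smooth, `Ric_g + Hess V ≥ K g`, `K > 0` and `∫ e^{-V} dV_g = 1`, the logarithmic Sobolev inequality
`∫ φ e^φ e^{-V} dV_g ≤ (2K)⁻¹ ∫ |∇φ|²_g e^φ e^{-V} dV_g` holds for every smooth `φ` with `∫ e^φ e^{-V} = 1` (with the integrability
provisos of the fact) — by the density step `bakryEmery_logSobolev_complete_of_eventuallyConst` (`BakryEmeryLogSobolevReduction.lean`)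
from `BakryEmeryComplete.logSobolev_eventuallyConst_gaffney` (previous Part).  EXACT discharge, Literature-side twin of
`Summit.SmoothPoincare4.SmoothPoincare4.Theorems.BakryEmeryComplete.bakryEmery_logSobolev_complete_holds` (same proof).
[cite: BakryGentilLedoux2014, Prop. 5.7.1 and Cor. 5.7.2 (p. 268)] [cite: CarrilloNi2009, Thm. 3.1 (p. 7)] [cite: BakryEmery1985] -/
theorem bakryEmery_logSobolev_complete_holds : bakryEmery_logSobolev_complete := by
  refine bakryEmery_logSobolev_complete_of_eventuallyConst ?_
  intro n M _ _ _ _ _ _ _ _ _ g _ V K hg hc hV hK hRic hmass φ hφ hφK hφmass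
  have hc' : ∀ (x : M) (r : NNReal), IsCompact {y : M | g.edist hg x y ≤ r} := fun x r ↦ by
    simpa only [Literature.Geometry.Lorentzian.PseudoRiemannianMetric.riemEDist_eq hg] using hc x r
  exact logSobolev_eventuallyConst_gaffney hg hc' hV hK hRic hmass φ hφ hφK hφmass

end Literature.Geometry.Riemannian

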